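import Mathlib.Algebra.BigOperators.Ring.Finset
import Mathlib.Algebra.Order.BigOperators.Ring.Finset
import Mathlib.Data.Fintype.BigOperators
import Mathlib.Algebra.BigOperators.Field
import Mathlib.Data.Real.Basic
import Mathlib.Analysis.SpecialFunctions.Pow.Real
import Mathlib.Tactic.Linarith
import Mathlib.Tactic.Ring
import Mathlib.Tactic.FieldSimp
import Mathlib.Tactic.DeriveFintype
import Literature.Computability.Complexity.CNF
import Literature.Computability.Complexity.SwitchingLemma
import HarnessLib

/-!
# The projection switching lemma of Rossman–Servedio–Tan (block random projections)

B. Rossman, R. A. Servedio, L.-Y. Tan, *An average-case depth hierarchy theorem for Boolean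
circuits*, FOCS 2015 / arXiv:1504.03398 [RossmanServedioTan2015], §9 ("Approximator simplifies
under random projections", pp. 24–29): the two projection switching lemmas of §9.1 (for `R_init`
and for `R(τ)`), proved through the canonical projection decision tree (§9.2, Def. 13 and the Fact
after it: "`Tree(G)` computes `proj G`"), the Razborov-style encoding
`θ(ρ) = (ρσ, π', encode(η), encode(γ))` of §9.3, its unique decodability (§9.4, the injection
proposition and the lemma before it) and the weight comparison lemma of §9.5 (eq. (18)–(19)).

This file proves ONE abstract counting statement, `RSTProj.psl_abstract`, from which both printed
propositions follow by plugging in the block laws of `R_init` and `R(τ)` (done in the sibling files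
on the random projections themselves). The abstraction is exactly what the printed proof uses:

* variables come in blocks, `X = A × P` (block `a : A`, position `i : P`), the new variables are
  `Y = A`; a restriction is `ρ : A → P → Option Bool` (`none` = `⋆`), and the `ρ`-projection of
  `F : {0,1}^{A × P} → {0,1}` is `y ↦ F (expand ρ y)` with `expand ρ y (a, i) = ρ a i` if fixed and
  `y a` otherwise (RST Def. 4);
* the random restriction is a PRODUCT over blocks of nonnegative block weights `ζ a : (P → Option
  Bool) → ℝ` (RST §9.5, Facts: `ξ(ρ) = ∏_a ζ_a(ρ_a)`);
* (support) a block string of positive weight containing a `⋆` contains no `•` (`• := bul`,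
  `∘ := !bul`; RST §9.3 (ii)–(iv): such blocks lie in `{⋆, ∘}^w`);
* (weights) completing the stars of such a block string multiplies its weight by at least
  `Γ · κ^{#new ∘}` with `κ ≥ 1` (RST eq. (18) and the two displays after it: `Γ = Ω(w^{1/4})`,
  `κ = (1 - t_k)/t_k` for `R(τ)`; `κ = 1` for `R_init`).

Conclusion (`psl_abstract`): for a DNF `F` over `A × P` whose terms have pairwise distinct variables
and width `≤ r`, and `s ≥ 1`, the total weight of the restrictions `ρ` whose canonical projection
decision tree `Tree(F↾ρ)` has depth `≥ s` is at most
`(total weight) · ((8r+10) (1 + κ⁻¹)^{r+1} / Γ)^s` (constants not optimised; RST state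
`(O(r 2^r w^{-1/4}))^s` and `(O(r e^{r t_k/(1-t_k)} w^{-1/4}))^s`); and (`exists_dtree_of_pcdt_lt`)
depth `< s` gives an honest decision tree over `A` of depth `≤ s - 1` computing the projection.

## Contents and proof architecture (RST §9.2–§9.5, organised like the tree's `SwitchingLemma.lean`)

* `DTree V`: decision trees over an arbitrary variable type (the tree's `DecisionTree n` is over
  `Fin n`; projections change the variable set at every stage, so a polymorphic copy is used).
  The list utilities `flatL`/`unflatL`/`list_eq_of_getElem?_eq` are those of `SwitchingLemma.lean`.
* `BRestr A P`, `expand`, `fill` (fill the stars of a set of blocks), `starBlocks`.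
* Terms under a block restriction: `Falsified`, `firstLive`, `freeLits`, `blkList`/`blkSet` (the
  blocks `η` of the free variables of a term), `tpol` (the values `σ` gives: satisfy the occurring
  literals, `•` elsewhere).
* `pcdtF fuel F ρ` / `pcdt`: the depth of the canonical projection decision tree `Tree(F↾ρ)`
  (RST Def. 13); `exists_dtree_of_pcdtF_le` ("`Tree(G)` computes `proj G`").
* Paths (`Stage`, `PathValid`, `PathValidLast`, `truncPath`), the star values `σ` (`starVal`) and
  the filled restriction `ρσ` (`badStar`), the code (`Letter`, `maskOf`, `badCode`), the decoder
  `decPath` and its correctness `decPath_encPath`, injectivity `badCode_injOn`, the weight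
  comparison `weight_badStar_ge` (with `maskTotal_eq_newCircTotal`: `Σ_a Δ_a = ‖encode(γ)‖`), and
  the count `psl_abstract`.

Nothing here is specific to the Sipser function or to the numerical parameters of RST, and no
probability theory is used (weights are finite sums); the instantiation to `R_init` / `R(τ)` and the
union bound over the gates of a circuit are done where those objects are defined.

## References

* [RossmanServedioTan2015] B. Rossman, R. A. Servedio, L.-Y. Tan, arXiv:1504.03398, §9 (pp. 24–29),
  read via `lit read arxiv:1504.03398` (pages as materialised there).
* P. Beame, *A switching lemma primer* (1994), §3 — the Razborov encoding this proof adapts (as RST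
  say, following Thapen's reformulation of Håstad's blockwise lemma).
-/

noncomputable section

namespace Literature.Computability.Complexity

namespace RSTProj

open Finset

/-! ### Decision trees over an arbitrary variable type -/

/-- A Boolean decision tree querying variables of type `V`. [folklore] -/
inductive DTree (V : Type*) : Type _
  /-- a leaf with its output bit -/
  | leaf (b : Bool) : DTree V
  /-- query `v`; continue with `t₀` on answer `false`, with `t₁` on `true` -/
  | node (v : V) (t₀ t₁ : DTree V) : DTree V

namespace DTree

variable {V : Type*}

/-- The output of the tree on the input `y`. [folklore] -/
def eval (y : V → Bool) : DTree V → Bool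
  | leaf b => b
  | node v t₀ t₁ => if y v then t₁.eval y else t₀.eval y

/-- The depth (largest number of queries on a path). [folklore] -/
def depth : DTree V → ℕ
  | leaf _ => 0
  | node _ t₀ t₁ => max t₀.depth t₁.depth + 1

/-- The negated tree. [folklore] -/
def negate : DTree V → DTree V
  | leaf b => leaf (!b)
  | node v t₀ t₁ => node v t₀.negate t₁.negate

/-- A leaf outputs its label. [folklore] -/
@[simp] theorem eval_leaf (y : V → Bool) (b : Bool) : (leaf b : DTree V).eval y = b := rfl

/-- A node branches on the queried bit. [folklore] -/
@[simp] theorem eval_node (y : V → Bool) (v : V) (t₀ t₁ : DTree V) :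
    (node v t₀ t₁).eval y = if y v then t₁.eval y else t₀.eval y := rfl

/-- A leaf has depth `0`. [folklore] -/
@[simp] theorem depth_leaf (b : Bool) : (leaf b : DTree V).depth = 0 := rfl

/-- Depth of a node. [folklore] -/
@[simp] theorem depth_node (v : V) (t₀ t₁ : DTree V) :
    (node v t₀ t₁).depth = max t₀.depth t₁.depth + 1 := rfl

/-- The negated tree computes the negation. [folklore] -/
theorem eval_negate (y : V → Bool) : ∀ T : DTree V, T.negate.eval y = !T.eval y
  | leaf b => rfl
  | node v t₀ t₁ => by
    simp only [negate, eval_node, eval_negate y t₀, eval_negate y t₁]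
    split <;> rfl

/-- Negation keeps the depth. [folklore] -/
@[simp] theorem depth_negate : ∀ T : DTree V, T.negate.depth = T.depth
  | leaf b => rfl
  | node v t₀ t₁ => by simp only [negate, depth_node, depth_negate t₀, depth_negate t₁]

/-- Query the variables of a list in order, accumulating the answers, then continue with `k`. [folklore] -/
def queryList [DecidableEq V] : List V → ((V → Bool) → DTree V) → (V → Bool) → DTree V
  | [], k, acc => k acc
  | v :: L, k, acc =>
    node v (queryList L k (Function.update acc v false)) (queryList L k (Function.update acc v true))

/-- The accumulated answers along the path followed by `y`. [folklore] -/
def accAnswers [DecidableEq V] : List V → (V → Bool) → (V → Bool) → V → Bool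
  | [], acc, _ => acc
  | v :: L, acc, y => accAnswers L (Function.update acc v (y v)) y

/-- Querying a list adds its length to the depth. [folklore] -/
theorem depth_queryList_le [DecidableEq V] {k : (V → Bool) → DTree V} {d : ℕ}
    (hk : ∀ a, (k a).depth ≤ d) :
    ∀ (L : List V) (acc : V → Bool), (queryList L k acc).depth ≤ L.length + d
  | [], acc => by simpa [queryList] using hk acc
  | v :: L, acc => by
    simp only [queryList, depth_node, List.length_cons]
    have h0 := depth_queryList_le hk L (Function.update acc v false)
    have h1 := depth_queryList_le hk L (Function.update acc v true)
    omega

/-- Evaluating the list query: the continuation receives the accumulated answers. [folklore] -/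
theorem eval_queryList [DecidableEq V] (k : (V → Bool) → DTree V) (y : V → Bool) :
    ∀ (L : List V) (acc : V → Bool), (queryList L k acc).eval y = (k (accAnswers L acc y)).eval y
  | [], acc => rfl
  | v :: L, acc => by
    simp only [queryList, eval_node, accAnswers]
    cases hy : y v
    · simpa using eval_queryList k y L (Function.update acc v false)
    · simpa using eval_queryList k y L (Function.update acc v true)

/-- Off the list the accumulated answers are the initial ones. [folklore] -/
theorem accAnswers_of_not_mem [DecidableEq V] (y : V → Bool) :
    ∀ (L : List V) (acc : V → Bool) {v : V}, v ∉ L → accAnswers L acc y v = acc v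
  | [], acc, v, _ => rfl
  | u :: L, acc, v, h => by
    simp only [List.mem_cons, not_or] at h
    simp only [accAnswers]
    rw [accAnswers_of_not_mem y L _ h.2, Function.update_of_ne h.1]

/-- On the list the accumulated answers are those of the input. [folklore] -/
theorem accAnswers_of_mem [DecidableEq V] (y : V → Bool) :
    ∀ (L : List V) (acc : V → Bool) {v : V}, v ∈ L → accAnswers L acc y v = y v
  | [], acc, v, h => absurd h (by simp)
  | u :: L, acc, v, h => by
    simp only [accAnswers]
    by_cases hvL : v ∈ L
    · exact accAnswers_of_mem y L _ hvL
    · have hvu : v = u := by simpa [hvL] using h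
      subst hvu
      rw [accAnswers_of_not_mem y L _ hvL, Function.update_self]

end DTree

/-! ### Block restrictions and projections -/

/-- A restriction of the block-structured variables `A × P`: `ρ a i = none` means `x_{a,i} = ⋆`.
[cite: RossmanServedioTan2015, Def. 4 (p. 14)] -/
abbrev BRestr (A P : Type*) : Type _ := A → P → Option Bool

namespace BRestr

variable {A P : Type*}

/-- The assignment of `A × P` read by a `ρ`-projected function on `y : A → Bool`: fixed variables
take their value, `x_{a,i} = y_a` if `ρ_{a,i} = ⋆`. [cite: RossmanServedioTan2015, Def. 4 (p. 14)] -/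
def expand (ρ : BRestr A P) (y : A → Bool) : A × P → Bool := fun v => (ρ v.1 v.2).getD (y v.1)

/-- Value of `expand`. [folklore] -/
theorem expand_apply (ρ : BRestr A P) (y : A → Bool) (a : A) (i : P) :
    ρ.expand y (a, i) = (ρ a i).getD (y a) := rfl

/-- Fill the stars of the blocks of `S` with the values `g` (other blocks unchanged).
[cite: RossmanServedioTan2015, Def. 12 (p. 25, `η ↦ π`) and §9.3 (`σ`)] -/
def fill [DecidableEq A] (ρ : BRestr A P) (S : Finset A) (g : A → P → Bool) : BRestr A P :=
  fun a i => if a ∈ S then some ((ρ a i).getD (g a i)) else ρ a i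

/-- Value of `fill`. [folklore] -/
theorem fill_apply [DecidableEq A] (ρ : BRestr A P) (S : Finset A) (g : A → P → Bool) (a : A) (i : P) :
    ρ.fill S g a i = if a ∈ S then some ((ρ a i).getD (g a i)) else ρ a i := rfl

/-- Filling keeps the fixed values. [folklore] -/
theorem fill_of_eq_some [DecidableEq A] {ρ : BRestr A P} {a : A} {i : P} {b : Bool} (h : ρ a i = some b)
    (S : Finset A) (g : A → P → Bool) : ρ.fill S g a i = some b := by
  rw [fill_apply, h]; split_ifs <;> rfl

/-- Off `S` filling does nothing. [folklore] -/
theorem fill_of_not_mem [DecidableEq A] {ρ : BRestr A P} {S : Finset A} {a : A} (h : a ∉ S) (g : A → P → Bool)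
    (i : P) : ρ.fill S g a i = ρ a i := by
  rw [fill_apply, if_neg h]

/-- On a star of a block of `S` filling writes `g`. [folklore] -/
theorem fill_of_mem_of_none [DecidableEq A] {ρ : BRestr A P} {S : Finset A} {a : A} (h : a ∈ S) {i : P}
    (hn : ρ a i = none) (g : A → P → Bool) : ρ.fill S g a i = some (g a i) := by
  rw [fill_apply, if_pos h, hn]; rfl

/-- After filling, the blocks of `S` have no star. [folklore] -/
theorem fill_ne_none_of_mem [DecidableEq A] (ρ : BRestr A P) {S : Finset A} {a : A} (h : a ∈ S)
    (g : A → P → Bool) (i : P) : ρ.fill S g a i ≠ none := by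
  rw [fill_apply, if_pos h]; exact Option.some_ne_none _

/-- A block has a star. [folklore] -/
def HasStar (ρ : BRestr A P) (a : A) : Prop := ∃ i, ρ a i = none

/-- Decidability of `HasStar`. [folklore] -/
instance [Fintype P] (ρ : BRestr A P) (a : A) : Decidable (ρ.HasStar a) :=
  inferInstanceAs (Decidable (∃ i, ρ a i = none))

/-- The blocks containing a star. [folklore] -/
def starBlocks [Fintype P] [Fintype A] (ρ : BRestr A P) : Finset A := univ.filter fun a => ρ.HasStar a

/-- Membership in `starBlocks`. [folklore] -/
@[simp] theorem mem_starBlocks [Fintype P] [Fintype A] {ρ : BRestr A P} {a : A} : a ∈ ρ.starBlocks ↔ ∃ i, ρ a i = none := by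
  simp [starBlocks, HasStar]

/-- Filling removes exactly the filled star blocks. [folklore] -/
theorem starBlocks_fill [DecidableEq A] [Fintype P] [Fintype A] (ρ : BRestr A P) (S : Finset A) (g : A → P → Bool) :
    (ρ.fill S g).starBlocks = ρ.starBlocks \ S := by
  ext a
  simp only [mem_starBlocks, Finset.mem_sdiff]
  constructor
  · rintro ⟨i, hi⟩
    by_cases ha : a ∈ S
    · exact absurd hi (fill_ne_none_of_mem ρ ha g i)
    · rw [fill_of_not_mem ha] at hi
      exact ⟨⟨i, hi⟩, ha⟩
  · rintro ⟨⟨i, hi⟩, ha⟩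
    exact ⟨i, by rw [fill_of_not_mem ha, hi]⟩

/-- Filling star blocks strictly decreases the number of star blocks. [folklore] -/
theorem card_starBlocks_fill_lt [DecidableEq A] [Fintype P] [Fintype A] {ρ : BRestr A P} {S : Finset A} (hS : S ⊆ ρ.starBlocks)
    (hne : S.Nonempty) (g : A → P → Bool) :
    (ρ.fill S g).starBlocks.card < ρ.starBlocks.card := by
  rw [starBlocks_fill]
  exact Finset.card_lt_card (Finset.sdiff_ssubset hS hne)

/-- Filling blocks with constants that agree with `y` does not change the expanded input. [folklore] -/
theorem expand_fill_const [DecidableEq A] {ρ : BRestr A P} {S : Finset A} {π y : A → Bool}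
    (h : ∀ a ∈ S, π a = y a) : (ρ.fill S fun a _ => π a).expand y = ρ.expand y := by
  funext v
  rcases v with ⟨a, i⟩
  simp only [expand_apply, fill_apply]
  by_cases ha : a ∈ S
  · rw [if_pos ha]
    cases ρ a i with
    | none => simp [h a ha]
    | some b => rfl
  · rw [if_neg ha]

/-- A restriction without stars reads no input. [folklore] -/
theorem expand_eq_of_forall_ne_none {ρ : BRestr A P} (h : ∀ a i, ρ a i ≠ none) (y y' : A → Bool) :
    ρ.expand y = ρ.expand y' := by
  funext v
  rcases v with ⟨a, i⟩
  simp only [expand_apply]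
  cases hv : ρ a i with
  | none => exact absurd hv (h a i)
  | some b => rfl

end BRestr

/-! ### Terms of a DNF over `A × P` under a block restriction -/

section Terms

variable {A P : Type*}

/-- A term (`Clause (A × P)` read conjunctively) is falsified by `ρ`: some literal is fixed to
false (`T↾ρ ≡ 0`). [cite: RossmanServedioTan2015, Def. 13 (p. 25)] -/
def Falsified (ρ : BRestr A P) (T : Clause (A × P)) : Prop := ∃ l ∈ T, ρ l.1.1 l.1.2 = some (!l.2)

/-- Decidability (syntactic check). [folklore] -/
instance (ρ : BRestr A P) (T : Clause (A × P)) : Decidable (Falsified ρ T) :=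
  inferInstanceAs (Decidable (∃ l ∈ T, ρ l.1.1 l.1.2 = some (!l.2)))

/-- The first term not falsified by `ρ` (the term examined by `Tree(F↾ρ)`), if any.
[cite: RossmanServedioTan2015, Def. 13 (p. 25)] -/
def firstLive (F : CNF (A × P)) (ρ : BRestr A P) : Option (Clause (A × P)) :=
  F.find? fun T => !decide (Falsified ρ T)

/-- The free literals of a term under `ρ`, in the order of the term. [cite: RossmanServedioTan2015, §9.3 (p. 25)] -/
def freeLits (ρ : BRestr A P) (T : Clause (A × P)) : List (Literal (A × P)) :=
  T.filter fun l => (ρ l.1.1 l.1.2).isNone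

/-- The blocks of the free variables of a term (`η`), listed once each, in order of first free
occurrence. [cite: RossmanServedioTan2015, Def. 13 and §9.3 (p. 25, `η`)] -/
def blkList [DecidableEq A] (ρ : BRestr A P) (T : Clause (A × P)) : List A := ((freeLits ρ T).map fun l => l.1.1).dedup

/-- The set `η` of blocks of the free variables of a term. [cite: RossmanServedioTan2015, Def. 13 (p. 25)] -/
def blkSet [DecidableEq A] (ρ : BRestr A P) (T : Clause (A × P)) : Finset A := ((freeLits ρ T).map fun l => l.1.1).toFinset

/-- The variables of a term are pairwise distinct. [folklore] -/
def VarNodup (T : Clause (A × P)) : Prop := (T.map Prod.fst).Nodup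

/-- Membership in the free literals. [folklore] -/
theorem mem_freeLits {ρ : BRestr A P} {T : Clause (A × P)} {l : Literal (A × P)} :
    l ∈ freeLits ρ T ↔ l ∈ T ∧ ρ l.1.1 l.1.2 = none := by
  simp [freeLits, Option.isNone_iff_eq_none]

/-- Membership in `η`. [folklore] -/
theorem mem_blkSet [DecidableEq A] {ρ : BRestr A P} {T : Clause (A × P)} {a : A} :
    a ∈ blkSet ρ T ↔ ∃ l ∈ T, l.1.1 = a ∧ ρ l.1.1 l.1.2 = none := by
  simp only [blkSet, List.mem_toFinset, List.mem_map, mem_freeLits]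
  constructor
  · rintro ⟨l, ⟨hl, hn⟩, rfl⟩; exact ⟨l, hl, rfl, hn⟩
  · rintro ⟨l, hl, rfl, hn⟩; exact ⟨l, ⟨hl, hn⟩, rfl⟩

/-- `blkList` lists `η`. [folklore] -/
theorem blkList_toFinset [DecidableEq A] (ρ : BRestr A P) (T : Clause (A × P)) : (blkList ρ T).toFinset = blkSet ρ T := by
  simp [blkList, blkSet, List.toFinset_eq_iff_perm_dedup, List.dedup_idem]

/-- Membership in `blkList`. [folklore] -/
theorem mem_blkList [DecidableEq A] {ρ : BRestr A P} {T : Clause (A × P)} {a : A} : a ∈ blkList ρ T ↔ a ∈ blkSet ρ T := by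
  rw [← blkList_toFinset, List.mem_toFinset]

/-- `blkList` has no duplicates. [folklore] -/
theorem nodup_blkList [DecidableEq A] (ρ : BRestr A P) (T : Clause (A × P)) : (blkList ρ T).Nodup := List.nodup_dedup _

/-- `η = ∅` iff the list is empty. [folklore] -/
theorem blkSet_eq_empty_iff [DecidableEq A] {ρ : BRestr A P} {T : Clause (A × P)} : blkSet ρ T = ∅ ↔ blkList ρ T = [] := by
  rw [← blkList_toFinset, List.toFinset_eq_empty_iff]

/-- The length of `blkList` is the size of `η`. [folklore] -/
theorem length_blkList [DecidableEq A] (ρ : BRestr A P) (T : Clause (A × P)) : (blkList ρ T).length = (blkSet ρ T).card := by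
  rw [← blkList_toFinset, List.toFinset_card_of_nodup (nodup_blkList ρ T)]

/-- Blocks of free variables are star blocks. [folklore] -/
theorem blkSet_subset_starBlocks [DecidableEq A] [Fintype P] [Fintype A] (ρ : BRestr A P) (T : Clause (A × P)) : blkSet ρ T ⊆ ρ.starBlocks := by
  intro a ha
  obtain ⟨l, _, rfl, hn⟩ := mem_blkSet.1 ha
  exact BRestr.mem_starBlocks.2 ⟨l.1.2, hn⟩

/-- Characterisation of `firstLive F ρ = some T`. [cite: RossmanServedioTan2015, Def. 13 (p. 25)] -/
theorem firstLive_eq_some_iff {F : CNF (A × P)} {ρ : BRestr A P} {T : Clause (A × P)} :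
    firstLive F ρ = some T ↔ ¬ Falsified ρ T ∧ ∃ as bs, F = as ++ T :: bs ∧ ∀ T' ∈ as, Falsified ρ T' := by
  unfold firstLive
  rw [List.find?_eq_some_iff_append]
  simp only [Bool.not_eq_eq_eq_not, Bool.not_true, decide_eq_false_iff_not, Bool.not_not,
    decide_eq_true_eq]

/-- There is no live term iff all terms are falsified. [cite: RossmanServedioTan2015, Def. 13 (p. 25)] -/
theorem firstLive_eq_none_iff {F : CNF (A × P)} {ρ : BRestr A P} :
    firstLive F ρ = none ↔ ∀ T ∈ F, Falsified ρ T := by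
  unfold firstLive
  rw [List.find?_eq_none]
  simp

/-- The first live term is a term of the DNF. [folklore] -/
theorem mem_of_firstLive {F : CNF (A × P)} {ρ : BRestr A P} {T : Clause (A × P)}
    (h : firstLive F ρ = some T) : T ∈ F := by
  obtain ⟨_, as, bs, hF, _⟩ := firstLive_eq_some_iff.1 h
  rw [hF]; simp

/-- **Transfer of the first live term**: if every term falsified by `ρ` is falsified by `ρ'` and the
first live term of `ρ` is not falsified by `ρ'`, it is the first live term of `ρ'`. [cite: RossmanServedioTan2015, §9.4 (p. 26)] -/
theorem firstLive_transfer {F : CNF (A × P)} {ρ ρ' : BRestr A P} {T : Clause (A × P)}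
    (hT : firstLive F ρ = some T) (hmono : ∀ T', Falsified ρ T' → Falsified ρ' T')
    (hnot : ¬ Falsified ρ' T) : firstLive F ρ' = some T := by
  obtain ⟨_, as, bs, hF, has⟩ := firstLive_eq_some_iff.1 hT
  exact firstLive_eq_some_iff.2 ⟨hnot, as, bs, hF, fun T' hT' => hmono T' (has T' hT')⟩

/-- Filling keeps falsified terms falsified. [folklore] -/
theorem Falsified.fill [DecidableEq A] {ρ : BRestr A P} {T : Clause (A × P)} (h : Falsified ρ T) (S : Finset A)
    (g : A → P → Bool) : Falsified (ρ.fill S g) T := by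
  obtain ⟨l, hl, hv⟩ := h
  exact ⟨l, hl, BRestr.fill_of_eq_some hv S g⟩

/-- A falsified term is false on every expanded input. [folklore] -/
theorem all_eq_false_of_falsified {ρ : BRestr A P} {T : Clause (A × P)} (h : Falsified ρ T) (y : A → Bool) :
    T.all (Literal.eval (ρ.expand y)) = false := by
  obtain ⟨l, hl, hv⟩ := h
  rw [List.all_eq_false]
  refine ⟨l, hl, ?_⟩
  have : ρ.expand y l.1 = !l.2 := by
    show (ρ l.1.1 l.1.2).getD (y l.1.1) = !l.2
    rw [hv]; rfl
  simp [Literal.eval, this]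

/-- A live term with no free literal is true on every expanded input. [folklore] -/
theorem all_eq_true_of_live_of_blkSet_eq_empty [DecidableEq A] {ρ : BRestr A P} {T : Clause (A × P)} (h : ¬ Falsified ρ T)
    (hfree : blkSet ρ T = ∅) (y : A → Bool) : T.all (Literal.eval (ρ.expand y)) = true := by
  rw [List.all_eq_true]
  intro l hl
  have hsome : ρ l.1.1 l.1.2 ≠ none := by
    intro hn
    have : l.1.1 ∈ blkSet ρ T := mem_blkSet.2 ⟨l, hl, rfl, hn⟩
    rw [hfree] at this; simp at this
  have hv : ρ l.1.1 l.1.2 = some l.2 := by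
    cases hρ : ρ l.1.1 l.1.2 with
    | none => exact absurd hρ hsome
    | some b =>
      cases hb : b <;> cases hl2 : l.2 <;> subst hb <;> simp_all <;> exact absurd ⟨l, hl, by rw [hρ, hl2]; rfl⟩ h
  have : ρ.expand y l.1 = l.2 := by
    show (ρ l.1.1 l.1.2).getD (y l.1.1) = l.2
    rw [hv]; rfl
  simp [Literal.eval, this]

end Terms

/-! ### The canonical projection decision tree (its depth) -/

section Canonical

variable {A P : Type*} [DecidableEq A] [Fintype P] [Fintype A]

/-- **Depth of the canonical projection decision tree** `Tree(F↾ρ)` (RST Def. 13): examine the first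
term not falsified; if there is none (`F↾ρ ≡ 0`) or it has no free literal (`F↾ρ ≡ 1`) stop;
otherwise query ALL the new variables `y_a`, `a ∈ η =` the blocks of its free variables, and for
each answer `π` continue with `ρ(η ↦ π)` (every star of the blocks of `η` set to `π_a`). `fuel`
bounds the number of rounds (the number of star blocks suffices). [cite: RossmanServedioTan2015, Def. 13 (p. 25)] -/
def pcdtF : ℕ → CNF (A × P) → BRestr A P → ℕ
  | 0, _, _ => 0
  | fuel + 1, F, ρ =>
    match firstLive F ρ with
    | none => 0
    | some T =>
      if blkSet ρ T = ∅ then 0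
      else (blkSet ρ T).card + univ.sup fun π : A → Bool => pcdtF fuel F (ρ.fill (blkSet ρ T) fun a _ => π a)

/-- The depth of `Tree(F↾ρ)` (fuel = number of blocks). [cite: RossmanServedioTan2015, Def. 13 (p. 25)] -/
def pcdt (F : CNF (A × P)) (ρ : BRestr A P) : ℕ := pcdtF (Fintype.card A) F ρ

/-- **`Tree(F↾ρ)` computes the projection** (RST §9.2, Fact): if the canonical projection decision tree
has depth `≤ ℓ` (and there is enough fuel) then `y ↦ F(expand ρ y)` is computed by a decision tree
over `A` of depth `≤ ℓ`. [cite: RossmanServedioTan2015, §9.2 (p. 25, Fact after Def. 13)] -/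
theorem exists_dtree_of_pcdtF_le (F : CNF (A × P)) :
    ∀ (fuel : ℕ) (ρ : BRestr A P) (ℓ : ℕ), ρ.starBlocks.card ≤ fuel → pcdtF fuel F ρ ≤ ℓ →
      ∃ T : DTree A, T.depth ≤ ℓ ∧ ∀ y, T.eval y = F.evalDNF (ρ.expand y)
  | 0, ρ, ℓ, hfuel, _ => by
    have h0 : ∀ a i, ρ a i ≠ none := by
      intro a i hn
      have : a ∈ ρ.starBlocks := BRestr.mem_starBlocks.2 ⟨i, hn⟩
      rw [Finset.card_eq_zero.1 (Nat.le_zero.1 hfuel)] at this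
      simp at this
    refine ⟨.leaf (F.evalDNF (ρ.expand fun _ => false)), Nat.zero_le _, fun y => ?_⟩
    rw [DTree.eval_leaf, BRestr.expand_eq_of_forall_ne_none h0 (fun _ => false) y]
  | fuel + 1, ρ, ℓ, hfuel, hdepth => by
    unfold pcdtF at hdepth
    cases hT : firstLive F ρ with
    | none =>
      refine ⟨.leaf false, Nat.zero_le _, fun y => ?_⟩
      rw [firstLive_eq_none_iff] at hT
      simp only [DTree.eval_leaf, CNF.evalDNF]
      symm; rw [List.any_eq_false]
      intro T hTF
      rw [all_eq_false_of_falsified (hT T hTF) y]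
      exact Bool.false_ne_true
    | some T =>
      rw [hT] at hdepth
      simp only at hdepth
      have hlive := (firstLive_eq_some_iff.1 hT).1
      have hTF := mem_of_firstLive hT
      split_ifs at hdepth with hS
      · refine ⟨.leaf true, Nat.zero_le _, fun y => ?_⟩
        simp only [DTree.eval_leaf, CNF.evalDNF]
        symm; rw [List.any_eq_true]
        exact ⟨T, hTF, all_eq_true_of_live_of_blkSet_eq_empty hlive hS y⟩
      · set S := blkSet ρ T with hSdef
        have hSsub : S ⊆ ρ.starBlocks := blkSet_subset_starBlocks ρ T
        have hSne : S.Nonempty := Finset.nonempty_iff_ne_empty.2 hS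
        have hsub : ∀ π : A → Bool, pcdtF fuel F (ρ.fill S fun a _ => π a) ≤ ℓ - S.card := by
          intro π
          have := Finset.le_sup (f := fun π : A → Bool => pcdtF fuel F (ρ.fill S fun a _ => π a))
            (Finset.mem_univ π)
          omega
        have hIH : ∀ π : A → Bool, ∃ T' : DTree A, T'.depth ≤ ℓ - S.card ∧
            ∀ y, T'.eval y = F.evalDNF ((ρ.fill S fun a _ => π a).expand y) := by
          intro π
          have hf : (ρ.fill S fun a _ => π a).starBlocks.card ≤ fuel := by
            have := BRestr.card_starBlocks_fill_lt hSsub hSne (fun a (_ : P) => π a); omega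
          exact exists_dtree_of_pcdtF_le F fuel _ (ℓ - S.card) hf (hsub π)
        choose Tf hTf using hIH
        refine ⟨DTree.queryList (blkList ρ T) Tf (fun _ => false), ?_, fun y => ?_⟩
        · refine (DTree.depth_queryList_le (fun π => (hTf π).1) _ _).trans ?_
          rw [length_blkList, ← hSdef]
          have : S.card ≤ ℓ := by omega
          omega
        · rw [DTree.eval_queryList]
          set π := DTree.accAnswers (blkList ρ T) (fun _ => false) y with hπdef
          have hπy : ∀ a ∈ S, π a = y a := fun a ha =>
            DTree.accAnswers_of_mem y _ _ (mem_blkList.2 ha)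
          rw [(hTf π).2 y, BRestr.expand_fill_const hπy]

/-- With the number of blocks as fuel, depth `≤ ℓ` gives a tree of depth `≤ ℓ`. [cite: RossmanServedioTan2015, §9.2 (p. 25, Fact after Def. 13)] -/
theorem exists_dtree_of_pcdt_le (F : CNF (A × P)) {ρ : BRestr A P} {ℓ : ℕ} (h : pcdt F ρ ≤ ℓ) :
    ∃ T : DTree A, T.depth ≤ ℓ ∧ ∀ y, T.eval y = F.evalDNF (ρ.expand y) :=
  exists_dtree_of_pcdtF_le F (Fintype.card A) ρ ℓ (Finset.card_le_univ _) h

end Canonical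

/-! ### Repetition-free terms: positions and satisfying values -/

section TermData

variable {A P : Type*}

/-- The value the encoding gives to the variable `v` in a block of the examined term `T`: the value
satisfying its literal if `v` occurs in `T`, and `•` (`bul`) otherwise (RST §9.3, definition of
`σ^ℓ`). [cite: RossmanServedioTan2015, §9.3 (p. 25, `σ^ℓ`)] -/
def tpol [DecidableEq A] [DecidableEq P] (bul : Bool) (T : Clause (A × P)) (v : A × P) : Bool :=
  match T.find? (fun l => l.1 = v) with
  | some l => l.2
  | none => bul

/-- The position in `T` of the first literal on a variable of the block `a` (`T.length` if none):
the "location of `x_{a,i₁}` in `T_ℓ`" recorded by `encode(η_ℓ)`. [cite: RossmanServedioTan2015, §9.3 (p. 25, `encode(η_ℓ)`)] -/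
def posBlk [DecidableEq A] (T : Clause (A × P)) (a : A) : ℕ := T.findIdx fun l => l.1.1 = a

/-- In a repetition-free term the literal on a variable is unique. [folklore] -/
theorem VarNodup.eq_of_mem {T : Clause (A × P)} (h : VarNodup T) {l l' : Literal (A × P)} (hl : l ∈ T)
    (hl' : l' ∈ T) (he : l.1 = l'.1) : l = l' := by
  obtain ⟨k, hk, rfl⟩ := List.getElem_of_mem hl
  obtain ⟨k', hk', rfl⟩ := List.getElem_of_mem hl'
  have e : (T.map Prod.fst)[k]'(by simpa using hk) = (T.map Prod.fst)[k']'(by simpa using hk') := by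
    simpa using he
  have hkk : k = k' := (List.Nodup.getElem_inj_iff h).1 e
  subst hkk; rfl

/-- In a repetition-free term distinct positions carry distinct variables. [folklore] -/
theorem VarNodup.getElem_fst_injective {T : Clause (A × P)} (h : VarNodup T) {k k' : ℕ}
    (hk : k < T.length) (hk' : k' < T.length) (he : (T[k]).1 = (T[k']).1) : k = k' := by
  have e : (T.map Prod.fst)[k]'(by simpa using hk) = (T.map Prod.fst)[k']'(by simpa using hk') := by
    simpa using he
  exact (List.Nodup.getElem_inj_iff h).1 e

/-- `tpol` satisfies every literal of a repetition-free term. [cite: RossmanServedioTan2015, §9.3 (p. 25, eq. (17))] -/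
theorem VarNodup.tpol_eq [DecidableEq A] [DecidableEq P] {T : Clause (A × P)} (h : VarNodup T)
    (bul : Bool) {l : Literal (A × P)} (hl : l ∈ T) : tpol bul T l.1 = l.2 := by
  unfold tpol
  cases hf : T.find? (fun l' => l'.1 = l.1) with
  | none => exact absurd (List.find?_eq_none.1 hf l hl) (by simp)
  | some l' =>
    have hl'T : l' ∈ T := List.mem_of_find?_eq_some hf
    have hl'1 : l'.1 = l.1 := by simpa using List.find?_some hf
    simp only
    rw [h.eq_of_mem hl'T hl hl'1]

/-- If `tpol` is not the default then the variable occurs in the term with that polarity. [folklore] -/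
theorem exists_mem_of_tpol_ne [DecidableEq A] [DecidableEq P] {bul : Bool} {T : Clause (A × P)}
    {v : A × P} (h : tpol bul T v ≠ bul) : ∃ l ∈ T, l.1 = v ∧ l.2 = tpol bul T v := by
  unfold tpol at h ⊢
  cases hf : T.find? (fun l' => l'.1 = v) with
  | none => rw [hf] at h; exact absurd rfl h
  | some l' =>
    refine ⟨l', List.mem_of_find?_eq_some hf, by simpa using List.find?_some hf, ?_⟩
    simp

/-- The literal at position `posBlk T a` lies in the block `a`, for `a` a block of `T`. [folklore] -/
theorem getElem_posBlk [DecidableEq A] {T : Clause (A × P)} {a : A} (h : ∃ l ∈ T, l.1.1 = a) :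
    ∃ hlt : posBlk T a < T.length, (T[posBlk T a]'hlt).1.1 = a := by
  obtain ⟨l, hl, hla⟩ := h
  unfold posBlk
  have hlt : (T.findIdx fun l => l.1.1 = a) < T.length := by
    rw [List.findIdx_lt_length]
    exact ⟨l, hl, by simp [hla]⟩
  refine ⟨hlt, ?_⟩
  have := List.findIdx_getElem (xs := T) (p := fun l => decide (l.1.1 = a)) (w := hlt)
  exact of_decide_eq_true this

end TermData

/-! ### Paths of the canonical projection decision tree -/

section Paths

variable {A P : Type*}

/-- A stage of a path of `Tree(F↾ρ)`: the term examined (`T_ℓ`), the blocks queried (`η_ℓ`, as a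
list) and the answers (`π^ℓ`, junk off the blocks). [cite: RossmanServedioTan2015, §9.3 (p. 25)] -/
structure Stage (A P : Type*) where
  /-- the term examined at this stage -/
  term : Clause (A × P)
  /-- the blocks queried at this stage -/
  vars : List A
  /-- the answers (junk off `vars`) -/
  ans : A → Bool

/-- The restriction after a stage: `ρ(η_ℓ ↦ π^ℓ)`. [cite: RossmanServedioTan2015, Def. 12 (p. 25)] -/
def Stage.next [DecidableEq A] (ρ : BRestr A P) (st : Stage A P) : BRestr A P := ρ.fill st.vars.toFinset fun a _ => st.ans a

/-- A *full* path of `Tree(F↾ρ)`: each stage examines the first live term and queries all the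
blocks of its free variables (at least one); the path continues from `ρ(η ↦ π)`. [cite: RossmanServedioTan2015, Def. 13 and §9.3 (p. 25)] -/
def PathValid [DecidableEq A] (F : CNF (A × P)) : BRestr A P → List (Stage A P) → Prop
  | _, [] => True
  | ρ, st :: rest => firstLive F ρ = some st.term ∧ st.vars = blkList ρ st.term ∧ st.vars ≠ [] ∧
      PathValid F (st.next ρ) rest

/-- Validity of a *truncated* path (the last stage queries a nonempty prefix of the blocks of its
term: RST's trimming of `η_j` to reach exactly `s` variables). [cite: RossmanServedioTan2015, §9.3 (p. 26, "we trim `η_j`")] -/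
def PathValidLast [DecidableEq A] (F : CNF (A × P)) : BRestr A P → List (Stage A P) → Prop
  | _, [] => False
  | ρ, [st] => firstLive F ρ = some st.term ∧ st.vars <+: blkList ρ st.term ∧ st.vars ≠ []
  | ρ, st :: st' :: rest => firstLive F ρ = some st.term ∧ st.vars = blkList ρ st.term ∧ st.vars ≠ [] ∧
      PathValidLast F (st.next ρ) (st' :: rest)

/-- The number of block variables queried along a path. [folklore] -/
def pathLen : List (Stage A P) → ℕ
  | [] => 0
  | st :: rest => st.vars.length + pathLen rest

/-- The empty path queries nothing. [folklore] -/
@[simp] theorem pathLen_nil : pathLen ([] : List (Stage A P)) = 0 := rfl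

/-- Length of a path, cons case. [folklore] -/
@[simp] theorem pathLen_cons (st : Stage A P) (rest : List (Stage A P)) :
    pathLen (st :: rest) = st.vars.length + pathLen rest := rfl

/-- The blocks queried along a path, in order. [folklore] -/
def pathVars : List (Stage A P) → List A
  | [] => []
  | st :: rest => st.vars ++ pathVars rest

/-- Blocks of the empty path. [folklore] -/
@[simp] theorem pathVars_nil : pathVars ([] : List (Stage A P)) = [] := rfl

/-- Blocks of a path, cons case. [folklore] -/
@[simp] theorem pathVars_cons (st : Stage A P) (rest : List (Stage A P)) :
    pathVars (st :: rest) = st.vars ++ pathVars rest := rfl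

/-- A path queries `pathLen` blocks. [folklore] -/
theorem length_pathVars : ∀ Pa : List (Stage A P), (pathVars Pa).length = pathLen Pa
  | [] => rfl
  | st :: rest => by simp [length_pathVars rest]

/-- **Deep trees have long paths**: if `Tree(F↾ρ)` has depth `> ℓ` there is a full path from `ρ`
querying more than `ℓ` block variables. [cite: RossmanServedioTan2015, §9.3 (p. 25, "the leftmost root-to-leaf path of length at least `s`")] -/
theorem exists_path_of_lt_pcdtF [DecidableEq A] [Fintype A] (F : CNF (A × P)) : ∀ (fuel : ℕ) (ρ : BRestr A P) (ℓ : ℕ),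
    ℓ < pcdtF fuel F ρ → ∃ Pa : List (Stage A P), PathValid F ρ Pa ∧ ℓ < pathLen Pa
  | 0, ρ, ℓ, h => by simp [pcdtF] at h
  | fuel + 1, ρ, ℓ, h => by
    unfold pcdtF at h
    cases hT : firstLive F ρ with
    | none => rw [hT] at h; simp at h
    | some T =>
      rw [hT] at h
      simp only at h
      split_ifs at h with hS
      · simp at h
      have hne : blkList ρ T ≠ [] := fun h' => hS (blkSet_eq_empty_iff.2 h')
      by_cases hlen : ℓ < (blkSet ρ T).card
      · refine ⟨[⟨T, blkList ρ T, fun _ => false⟩], ⟨hT, rfl, hne, trivial⟩, ?_⟩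
        simp only [pathLen_cons, pathLen_nil, add_zero, length_blkList]
        exact hlen
      · push Not at hlen
        have hsup : ℓ - (blkSet ρ T).card <
            univ.sup (fun π : A → Bool => pcdtF fuel F (ρ.fill (blkSet ρ T) fun a _ => π a)) := by
          omega
        rw [Finset.lt_sup_iff] at hsup
        obtain ⟨π, _, hπ⟩ := hsup
        obtain ⟨Pa, hPa, hlenPa⟩ := exists_path_of_lt_pcdtF F fuel (ρ.fill (blkSet ρ T) fun a _ => π a) _ hπ
        refine ⟨⟨T, blkList ρ T, π⟩ :: Pa, ⟨hT, rfl, hne, ?_⟩, ?_⟩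
        · simpa [Stage.next, blkList_toFinset] using hPa
        · simp only [pathLen_cons, length_blkList]
          omega

/-- Truncation of a path to its first `b` block variables. [cite: RossmanServedioTan2015, §9.3 (p. 26, trimming)] -/
def truncPath : List (Stage A P) → ℕ → List (Stage A P)
  | [], _ => []
  | st :: rest, b =>
    if b ≤ st.vars.length then [{ st with vars := st.vars.take b }]
    else st :: truncPath rest (b - st.vars.length)

/-- **Truncation**: cutting a full path at `1 ≤ b ≤` its length gives a valid truncated path with
exactly `b` block variables. [cite: RossmanServedioTan2015, §9.3 (p. 26, trimming)] -/
theorem truncPath_valid [DecidableEq A] {F : CNF (A × P)} :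
    ∀ {ρ : BRestr A P} {Pa : List (Stage A P)} {b : ℕ}, PathValid F ρ Pa → 1 ≤ b → b ≤ pathLen Pa →
      PathValidLast F ρ (truncPath Pa b) ∧ pathLen (truncPath Pa b) = b
  | ρ, [], b, _, h1, hb => by simp at hb; omega
  | ρ, st :: rest, b, ⟨hT, hvars, hne, hrest⟩, h1, hb => by
    unfold truncPath
    split_ifs with hle
    · refine ⟨⟨hT, ?_, ?_⟩, ?_⟩
      · simp only; rw [hvars]; exact List.take_prefix _ _
      · simp only
        intro h
        have := congrArg List.length h
        rw [List.length_take, List.length_nil] at this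
        have : 0 < st.vars.length := List.length_pos_iff.2 hne
        omega
      · simp [List.length_take, Nat.min_eq_left hle]
    · push Not at hle
      have hb' : b - st.vars.length ≤ pathLen rest := by simp at hb; omega
      have ih := truncPath_valid hrest (by omega) hb'
      have hne' : truncPath rest (b - st.vars.length) ≠ [] := by
        intro h; have := ih.1; rw [h] at this; exact this
      obtain ⟨st', rest', hrw⟩ := List.exists_cons_of_ne_nil hne'
      refine ⟨?_, ?_⟩
      · rw [hrw]
        refine ⟨hT, hvars, hne, ?_⟩
        rw [← hrw]; exact ih.1
      · simp only [pathLen_cons, ih.2]; omega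

/-- A valid truncated path is nonempty. [folklore] -/
theorem PathValidLast.ne_nil [DecidableEq A] {F : CNF (A × P)} {ρ : BRestr A P} {Pa : List (Stage A P)}
    (h : PathValidLast F ρ Pa) : Pa ≠ [] := by
  rintro rfl; exact h

/-- The star blocks after a stage. [folklore] -/
theorem Stage.starBlocks_next [DecidableEq A] [Fintype P] [Fintype A] (ρ : BRestr A P) (st : Stage A P) :
    (st.next ρ).starBlocks = ρ.starBlocks \ st.vars.toFinset :=
  BRestr.starBlocks_fill _ _ _

/-- Along a valid truncated path of a DNF the queried blocks are pairwise distinct star blocks. [cite: RossmanServedioTan2015, §9.3 (p. 25, "disjoint sets `η_1, …, η_j`")] -/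
theorem PathValidLast.nodup_star [DecidableEq A] [Fintype P] [Fintype A] {F : CNF (A × P)} :
    ∀ {ρ : BRestr A P} {Pa : List (Stage A P)}, PathValidLast F ρ Pa →
      (pathVars Pa).Nodup ∧ ∀ a ∈ pathVars Pa, a ∈ ρ.starBlocks
  | ρ, [], h => absurd h id
  | ρ, [st], ⟨_, hpre, _⟩ => by
    simp only [pathVars_cons, pathVars_nil, List.append_nil]
    refine ⟨hpre.sublist.nodup (nodup_blkList ρ st.term), fun a ha => ?_⟩
    exact blkSet_subset_starBlocks ρ st.term (mem_blkList.1 (hpre.subset ha))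
  | ρ, st :: st' :: rest, ⟨_, hvars, _, hrest⟩ => by
    have ih := PathValidLast.nodup_star hrest
    have hst : st.vars.Nodup := by rw [hvars]; exact nodup_blkList ρ st.term
    have hststar : ∀ a ∈ st.vars, a ∈ ρ.starBlocks := by
      intro a ha; rw [hvars] at ha
      exact blkSet_subset_starBlocks ρ st.term (mem_blkList.1 ha)
    refine ⟨List.nodup_append.2 ⟨hst, ih.1, ?_⟩, ?_⟩
    · rintro a ha _ ha' rfl
      have := ih.2 a ha'
      rw [Stage.starBlocks_next, Finset.mem_sdiff] at this
      exact this.2 (List.mem_toFinset.2 ha)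
    · intro a ha
      rw [pathVars_cons] at ha
      rcases List.mem_append.1 ha with h | h
      · exact hststar a h
      · have := ih.2 a h
        rw [Stage.starBlocks_next, Finset.mem_sdiff] at this
        exact this.1

/-- Stages of a valid truncated path query at least one block. [folklore] -/
theorem PathValidLast.stages_ne_nil [DecidableEq A] {F : CNF (A × P)} : ∀ {ρ : BRestr A P} {Pa : List (Stage A P)},
    PathValidLast F ρ Pa → ∀ st ∈ Pa, st.vars ≠ []
  | _, [], h, _, _ => absurd h id
  | ρ, [st'], ⟨_, _, hne⟩, st, hst => by
    simp only [List.mem_singleton] at hst; subst hst; exact hne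
  | ρ, st' :: st'' :: rest, ⟨_, _, hne, hrest⟩, st, hst => by
    rcases List.mem_cons.1 hst with rfl | hst
    · exact hne
    · exact PathValidLast.stages_ne_nil hrest st hst

/-- The terms examined along a valid truncated path are terms of the DNF. [folklore] -/
theorem PathValidLast.term_mem [DecidableEq A] {F : CNF (A × P)} : ∀ {ρ : BRestr A P} {Pa : List (Stage A P)},
    PathValidLast F ρ Pa → ∀ st ∈ Pa, st.term ∈ F
  | _, [], h, _, _ => absurd h id
  | ρ, [st'], ⟨hT, _, _⟩, st, hst => by
    simp only [List.mem_singleton] at hst; subst hst; exact mem_of_firstLive hT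
  | ρ, st' :: st'' :: rest, ⟨hT, _, _, hrest⟩, st, hst => by
    rcases List.mem_cons.1 hst with rfl | hst
    · exact mem_of_firstLive hT
    · exact PathValidLast.term_mem hrest st hst

/-- The blocks of a stage of a valid truncated path are blocks of (free variables of) its term. [folklore] -/
theorem PathValidLast.vars_sub [DecidableEq A] {F : CNF (A × P)} : ∀ {ρ : BRestr A P} {Pa : List (Stage A P)},
    PathValidLast F ρ Pa → ∀ st ∈ Pa, ∀ a ∈ st.vars, ∃ l ∈ st.term, l.1.1 = a
  | _, [], h, _, _, _, _ => absurd h id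
  | ρ, [st'], ⟨_, hpre, _⟩, st, hst, a, ha => by
    simp only [List.mem_singleton] at hst; subst hst
    obtain ⟨l, hl, hla, _⟩ := mem_blkSet.1 (mem_blkList.1 (hpre.subset ha))
    exact ⟨l, hl, hla⟩
  | ρ, st' :: st'' :: rest, ⟨_, hvars, _, hrest⟩, st, hst, a, ha => by
    rcases List.mem_cons.1 hst with rfl | hst
    · rw [hvars] at ha
      obtain ⟨l, hl, hla, _⟩ := mem_blkSet.1 (mem_blkList.1 ha)
      exact ⟨l, hl, hla⟩
    · exact PathValidLast.vars_sub hrest st hst a ha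

end Paths

/-! ### The encoding of bad restrictions and its decoding (RST §9.3–§9.4) -/

section Coding

variable {A P : Type*}

/-- The values `σ = σ^1 ⋯ σ^j` written into the stars of the queried blocks: in a block of stage `ℓ`,
the value satisfying the literal of `T_ℓ` on that variable if it occurs in `T_ℓ`, and `•`
otherwise. [cite: RossmanServedioTan2015, §9.3 (p. 25, definition of `σ^ℓ`)] -/
def starVal [DecidableEq A] [DecidableEq P] (bul : Bool) : List (Stage A P) → A → P → Bool
  | [] => fun _ _ => bul
  | st :: rest => fun a i => if a ∈ st.vars then tpol bul st.term (a, i) else starVal bul rest a i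

/-- A code letter for one queried block variable `y_a ∈ η_ℓ`: the location in `T_ℓ` of a literal of
the block `a` (`log r` bits) and the path answer `π^ℓ_a` (RST: `encode(η_ℓ)` and `π'`; the "last
variable of `η_ℓ`" bit is the block mark of `flatL`). [cite: RossmanServedioTan2015, §9.3 (p. 25–26)] -/
structure Letter (r : ℕ) where
  /-- location of a literal of the block in the examined term (`< r` for terms of width `≤ r`) -/
  pos : Fin (r + 1)
  /-- the answer of the path on this block variable -/
  bit : Bool
  deriving DecidableEq, Fintype

/-- The letters of a stage. [cite: RossmanServedioTan2015, §9.3 (p. 25, `encode(η_ℓ)`)] -/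
def encStage [DecidableEq A] (r : ℕ) (st : Stage A P) : List (Letter r) :=
  st.vars.map fun a => ⟨⟨min (posBlk st.term a) r, by omega⟩, st.ans a⟩

/-- The mask `encode(γ_ℓ) ∈ {0,1}^r` of a stage: the locations in `T_ℓ` of the literals whose (starred)
variable `σ^ℓ` sets to `∘` (Hamming weight `|γ_ℓ|` = the number of new `∘`'s). [cite: RossmanServedioTan2015, §9.3 (p. 26, `encode(γ_ℓ)`)] -/
def maskOf [DecidableEq A] (r : ℕ) (bul : Bool) (ρ : BRestr A P) (st : Stage A P) : Fin (r + 1) → Bool :=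
  fun p => match st.term[p.val]? with
    | none => false
    | some l => decide (l.1.1 ∈ st.vars ∧ ρ l.1.1 l.1.2 = none ∧ l.2 = !bul)

/-- The code of a path from `ρ`: letters and mask of each stage (the mask of stage `ℓ` is computed
in `ρ(η_1 ↦ π^1)⋯(η_{ℓ-1} ↦ π^{ℓ-1})`, which agrees with `ρ` on the blocks of `η_ℓ`). [cite: RossmanServedioTan2015, §9.3–9.4 (p. 25–26)] -/
def encPath [DecidableEq A] (r : ℕ) (bul : Bool) :
    BRestr A P → List (Stage A P) → List (List (Letter r) × (Fin (r + 1) → Bool))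
  | _, [] => []
  | ρ, st :: rest => (encStage r st, maskOf r bul ρ st) :: encPath r bul (st.next ρ) rest

/-- Decoding the letters of a stage against its term: the blocks and the path answers. [cite: RossmanServedioTan2015, §9.4 (p. 26, the injection proposition)] -/
def decBlocks {r : ℕ} (T : Clause (A × P)) (es : List (Letter r)) : List (A × Bool) :=
  es.filterMap fun e => (T[e.pos.val]?).map fun l => (l.1.1, e.bit)

/-- Reading an answer off a decoded list (junk `false`). [folklore] -/
def bitOf [DecidableEq A] (q : List (A × Bool)) (a : A) : Bool :=
  match q.find? (fun x => x.1 = a) with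
  | some x => x.2
  | none => false

/-- The decoder's reconstruction `U_a` of the stars of a queried block (RST §9.4: "`U_a = {i :
(ρσ)_{a,i} = 0` or `x_{a,i} ∈ γ}`"): the positions now holding `•`, and the variables of the masked
literals. [cite: RossmanServedioTan2015, §9.4 (p. 26, `U_a`)] -/
def InU (r : ℕ) (bul : Bool) (H : BRestr A P) (T : Clause (A × P)) (M : Fin (r + 1) → Bool)
    (a : A) (i : P) : Prop :=
  H a i = some bul ∨ ∃ p : Fin (r + 1), M p = true ∧ (T[p.val]?).map Prod.fst = some (a, i)

/-- Decidability of `InU`. [folklore] -/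
instance [DecidableEq A] [DecidableEq P] (r : ℕ) (bul : Bool) (H : BRestr A P) (T : Clause (A × P))
    (M : Fin (r + 1) → Bool) (a : A) (i : P) : Decidable (InU r bul H T M a i) :=
  inferInstanceAs (Decidable (_ ∨ ∃ p : Fin (r + 1), M p = true ∧ (T[p.val]?).map Prod.fst = some (a, i)))

/-- "Undo `σ^ℓ` and put `π^ℓ`": the next hybrid restriction of the decoder. [cite: RossmanServedioTan2015, §9.4 (p. 26, the injection proposition)] -/
def undo [DecidableEq A] [DecidableEq P] (r : ℕ) (bul : Bool) (H : BRestr A P) (T : Clause (A × P))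
    (M : Fin (r + 1) → Bool) (bl : List A) (π : A → Bool) : BRestr A P :=
  fun a i => if a ∈ bl ∧ InU r bul H T M a i then some (π a) else H a i

/-- Restore the stars of the queried blocks of a stage in the decoded restriction. [cite: RossmanServedioTan2015, §9.4 (p. 26, last paragraph of the proof)] -/
def restore [DecidableEq A] [DecidableEq P] (r : ℕ) (bul : Bool) (H : BRestr A P) (T : Clause (A × P))
    (M : Fin (r + 1) → Bool) (bl : List A) (R : BRestr A P) : BRestr A P :=
  fun a i => if a ∈ bl ∧ InU r bul H T M a i then none else R a i

/-- **The decoder** (RST §9.4): from the hybrid restriction `H = ρ(η_1↦π^1)⋯(η_{ℓ-1}↦π^{ℓ-1})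
σ^ℓ⋯σ^j` and the remaining code: the examined term `T_ℓ` is the first live term of `H`; the letters
give `η_ℓ` and `π^ℓ`, the `•`'s of `H` and the mask give the stars `U` of the blocks of `η_ℓ`;
recurse on the next hybrid and finally free the positions `U` again. [cite: RossmanServedioTan2015, §9.4 (p. 26, the injection proposition)] -/
def decPath [DecidableEq A] [DecidableEq P] (F : CNF (A × P)) (r : ℕ) (bul : Bool) :
    BRestr A P → List (List (Letter r) × (Fin (r + 1) → Bool)) → BRestr A P
  | H, [] => H
  | H, (es, M) :: rest =>
    match firstLive F H with
    | none => H
    | some T =>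
      restore r bul H T M ((decBlocks T es).map Prod.fst)
        (decPath F r bul (undo r bul H T M ((decBlocks T es).map Prod.fst) (bitOf (decBlocks T es))) rest)

/-! #### Correctness of the decoding -/

/-- Reading back a graph list. [folklore] -/
theorem bitOf_map_self [DecidableEq A] {vs : List A} (g : A → Bool) {a : A} (ha : a ∈ vs) :
    bitOf (vs.map fun v => (v, g v)) a = g a := by
  unfold bitOf
  rw [List.find?_map]
  cases hf : vs.find? ((fun x : A × Bool => decide (x.1 = a)) ∘ fun v => (v, g v)) with
  | none =>
    exfalso
    rw [List.find?_eq_none] at hf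
    exact absurd (by simp) (hf a ha)
  | some v =>
    have := List.find?_some hf
    simp only [Function.comp_apply, decide_eq_true_eq] at this
    simp [this]

/-- **Decoding the letters of a stage** against its term gives back its blocks and answers. [cite: RossmanServedioTan2015, §9.4 (p. 26, the injection proposition)] -/
theorem decBlocks_encStage [DecidableEq A] {r : ℕ} {T : Clause (A × P)} (hT : T.length ≤ r) (ans : A → Bool) :
    ∀ {vs : List A}, (∀ a ∈ vs, ∃ l ∈ T, l.1.1 = a) →
      decBlocks T (vs.map fun a => (⟨⟨min (posBlk T a) r, by omega⟩, ans a⟩ : Letter r)) =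
        vs.map fun a => (a, ans a)
  | [], _ => rfl
  | a :: vs, h => by
    obtain ⟨hlt, ha⟩ := getElem_posBlk (h a (by simp))
    have hmin : min (posBlk T a) r = posBlk T a := Nat.min_eq_left (by omega)
    simp only [List.map_cons, decBlocks, List.filterMap_cons]
    rw [show T[min (posBlk T a) r]? = some T[posBlk T a] by rw [hmin]; exact List.getElem?_eq_getElem hlt]
    simp only [Option.map_some, ha]
    congr 1
    exact decBlocks_encStage hT ans (fun b hb => h b (by simp [hb]))

/-- The hybrid restriction on a star of a block of the current stage holds the `σ`-value. [folklore] -/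
theorem hybrid_of_none [DecidableEq A] [DecidableEq P] {bul : Bool} {ρ : BRestr A P} {W : Finset A}
    {st : Stage A P} {rest : List (Stage A P)} {a : A} (haW : a ∈ W) (ha : a ∈ st.vars) {i : P}
    (hn : ρ a i = none) :
    ρ.fill W (starVal bul (st :: rest)) a i = some (tpol bul st.term (a, i)) := by
  rw [BRestr.fill_of_mem_of_none haW hn]
  simp [starVal, ha]

/-- **The examined term survives** (RST §9.4, Lemma): the first live term of the hybrid restriction is
the term of the stage, provided every block of `W` holding a free variable of the term is queried at
this stage. [cite: RossmanServedioTan2015, §9.4 (p. 26, the lemma before the injection proposition)] -/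
theorem firstLive_hybrid [DecidableEq A] [DecidableEq P] {F : CNF (A × P)} (hF : ∀ T ∈ F, VarNodup T)
    {bul : Bool} {ρ : BRestr A P} {st : Stage A P} {rest : List (Stage A P)} {W : Finset A}
    (hT : firstLive F ρ = some st.term)
    (hcov : ∀ l ∈ st.term, l.1.1 ∈ W → ρ l.1.1 l.1.2 = none → l.1.1 ∈ st.vars) :
    firstLive F (ρ.fill W (starVal bul (st :: rest))) = some st.term := by
  refine firstLive_transfer hT (fun T' hT' => hT'.fill W _) ?_
  rintro ⟨l, hl, hv⟩
  have hlive := (firstLive_eq_some_iff.1 hT).1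
  cases hρ : ρ l.1.1 l.1.2 with
  | some b =>
    rw [BRestr.fill_of_eq_some hρ] at hv
    exact hlive ⟨l, hl, by rw [hρ]; exact hv⟩
  | none =>
    by_cases hlW : l.1.1 ∈ W
    · have hmem := hcov l hl hlW hρ
      rw [hybrid_of_none hlW hmem hρ, (hF _ (mem_of_firstLive hT)).tpol_eq bul hl] at hv
      simp at hv
    · rw [BRestr.fill_of_not_mem hlW, hρ] at hv
      exact (Option.some_ne_none _) hv.symm

/-- Unfolding the mask. [folklore] -/
theorem maskOf_eq_true_iff [DecidableEq A] {r : ℕ} {bul : Bool} {ρ : BRestr A P} {st : Stage A P}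
    {p : Fin (r + 1)} : maskOf r bul ρ st p = true ↔
      ∃ l, st.term[p.val]? = some l ∧ l.1.1 ∈ st.vars ∧ ρ l.1.1 l.1.2 = none ∧ l.2 = !bul := by
  unfold maskOf
  cases h : st.term[p.val]? with
  | none => simp
  | some l => simp

/-- **The decoder finds the stars** (RST §9.4, "`U_a`"): in a queried block of the current
stage, a position is a `•` of the hybrid restriction or the variable of a masked literal iff it was
a star — because the block had no `•` before (support hypothesis) and `σ` writes `•` except on the
literals it satisfies with `∘`, which are masked. [cite: RossmanServedioTan2015, §9.4 (p. 26, the injection proposition)] -/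
theorem inU_iff [DecidableEq A] [DecidableEq P] {r : ℕ} {bul : Bool} {ρ : BRestr A P} {W : Finset A}
    {st : Stage A P} {rest : List (Stage A P)} (hlen : st.term.length ≤ r)
    {a : A} (haW : a ∈ W) (ha : a ∈ st.vars) (hbul : ∀ i, ρ a i ≠ some bul) (i : P) :
    InU r bul (ρ.fill W (starVal bul (st :: rest))) st.term (maskOf r bul ρ st) a i ↔ ρ a i = none := by
  constructor
  · rintro (h | ⟨p, hp, hpi⟩)
    · cases hρ : ρ a i with
      | none => rfl
      | some b =>
        rw [BRestr.fill_of_eq_some hρ] at h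
        exact absurd (hρ.trans h) (hbul i)
    · obtain ⟨l, hl, _, hn, _⟩ := maskOf_eq_true_iff.1 hp
      rw [hl] at hpi
      simp only [Option.map_some, Option.some.injEq] at hpi
      rw [show a = l.1.1 from (congrArg Prod.fst hpi).symm, show i = l.1.2 from (congrArg Prod.snd hpi).symm]
      exact hn
  · intro hn
    by_cases ht : tpol bul st.term (a, i) = bul
    · left; rw [hybrid_of_none haW ha hn, ht]
    · right
      obtain ⟨l, hl, hl1, hl2⟩ := exists_mem_of_tpol_ne ht
      obtain ⟨k, hk, rfl⟩ := List.getElem_of_mem hl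
      refine ⟨⟨k, by omega⟩, ?_, ?_⟩
      · rw [maskOf_eq_true_iff]
        refine ⟨st.term[k], List.getElem?_eq_getElem hk, ?_, ?_, ?_⟩
        · rw [show (st.term[k]).1.1 = a from congrArg Prod.fst hl1]; exact ha
        · rw [show (st.term[k]).1.1 = a from congrArg Prod.fst hl1,
            show (st.term[k]).1.2 = i from congrArg Prod.snd hl1]; exact hn
        · rw [hl2]
          cases hb : bul <;> cases htp : tpol bul st.term (a, i) <;> simp_all
      · simp only [List.getElem?_eq_getElem hk, Option.map_some, hl1]

/-- **Undoing `σ^ℓ` and putting `π^ℓ`** gives the next hybrid restriction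
`ρ(η_ℓ ↦ π^ℓ) σ^{ℓ+1} ⋯ σ^j`. [cite: RossmanServedioTan2015, §9.4 (p. 26, the injection proposition)] -/
theorem undo_hybrid [DecidableEq A] [DecidableEq P] {r : ℕ} {bul : Bool} {ρ : BRestr A P} {W : Finset A}
    {st : Stage A P} {rest : List (Stage A P)} (hlen : st.term.length ≤ r)
    (hstW : ∀ a ∈ st.vars, a ∈ W) (hbul : ∀ a ∈ st.vars, ∀ i, ρ a i ≠ some bul) {π : A → Bool}
    (hπ : ∀ a ∈ st.vars, π a = st.ans a) :
    undo r bul (ρ.fill W (starVal bul (st :: rest))) st.term (maskOf r bul ρ st) st.vars π =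
      (st.next ρ).fill (W \ st.vars.toFinset) (starVal bul rest) := by
  funext a i
  unfold undo
  by_cases ha : a ∈ st.vars
  · have key := inU_iff (rest := rest) hlen (hstW a ha) ha (hbul a ha) i
    have hnot : a ∉ W \ st.vars.toFinset := by simp [ha]
    rw [BRestr.fill_of_not_mem hnot]
    cases hρ : ρ a i with
    | none =>
      rw [if_pos ⟨ha, key.2 hρ⟩, hπ a ha]
      unfold Stage.next
      rw [BRestr.fill_of_mem_of_none (List.mem_toFinset.2 ha) hρ]
    | some b =>
      have : ¬ InU r bul (ρ.fill W (starVal bul (st :: rest))) st.term (maskOf r bul ρ st) a i := by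
        rw [key, hρ]; exact Option.some_ne_none b
      rw [if_neg (fun h => this h.2), BRestr.fill_of_eq_some hρ]
      unfold Stage.next
      rw [BRestr.fill_of_eq_some hρ]
  · rw [if_neg (fun h => ha h.1)]
    have hnext : st.next ρ a i = ρ a i := by
      unfold Stage.next; rw [BRestr.fill_of_not_mem]; simpa using ha
    by_cases haW : a ∈ W
    · have haW' : a ∈ W \ st.vars.toFinset := Finset.mem_sdiff.2 ⟨haW, by simpa using ha⟩
      rw [BRestr.fill_apply, if_pos haW, BRestr.fill_apply, if_pos haW', hnext]
      simp [starVal, ha]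
    · have haW' : a ∉ W \ st.vars.toFinset := fun h => haW (Finset.mem_sdiff.1 h).1
      rw [BRestr.fill_of_not_mem haW, BRestr.fill_of_not_mem haW', hnext]

/-- **Restoring the stars** of the blocks of the stage in `ρ(η_ℓ ↦ π^ℓ)` gives back `ρ`. [cite: RossmanServedioTan2015, §9.4 (p. 26, the injection proposition)] -/
theorem restore_hybrid [DecidableEq A] [DecidableEq P] {r : ℕ} {bul : Bool} {ρ : BRestr A P} {W : Finset A}
    {st : Stage A P} {rest : List (Stage A P)} (hlen : st.term.length ≤ r)
    (hstW : ∀ a ∈ st.vars, a ∈ W) (hbul : ∀ a ∈ st.vars, ∀ i, ρ a i ≠ some bul) :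
    restore r bul (ρ.fill W (starVal bul (st :: rest))) st.term (maskOf r bul ρ st) st.vars (st.next ρ) = ρ := by
  funext a i
  unfold restore
  by_cases ha : a ∈ st.vars
  · have key := inU_iff (rest := rest) hlen (hstW a ha) ha (hbul a ha) i
    cases hρ : ρ a i with
    | none => rw [if_pos ⟨ha, key.2 hρ⟩]
    | some b =>
      have : ¬ InU r bul (ρ.fill W (starVal bul (st :: rest))) st.term (maskOf r bul ρ st) a i := by
        rw [key, hρ]; exact Option.some_ne_none b
      rw [if_neg (fun h => this h.2)]
      unfold Stage.next
      rw [BRestr.fill_of_eq_some hρ]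
  · rw [if_neg (fun h => ha h.1)]
    unfold Stage.next; rw [BRestr.fill_of_not_mem]; simpa using ha

/-- Filling no block does nothing. [folklore] -/
theorem BRestr.fill_empty [DecidableEq A] (ρ : BRestr A P) (g : A → P → Bool) : ρ.fill ∅ g = ρ := by
  funext a i; exact BRestr.fill_of_not_mem (Finset.notMem_empty a) g i

/-- **Decoding recovers the restriction** (RST §9.4): from `ρσ = ρ ⊕_W σ` (`W` the blocks of a
valid truncated path, `σ` the star values) and the code of the path, `decPath` returns `ρ` — provided
no queried block of `ρ` holds a `•` (the support hypothesis). [cite: RossmanServedioTan2015, §9.4 (p. 26, the injection proposition)] -/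
theorem decPath_encPath [DecidableEq A] [DecidableEq P] [Fintype A] [Fintype P] {F : CNF (A × P)} {r : ℕ}
    (bul : Bool)
    (hF : ∀ T ∈ F, VarNodup T) (hr : ∀ T ∈ F, T.length ≤ r) :
    ∀ {ρ : BRestr A P} {Pa : List (Stage A P)}, PathValidLast F ρ Pa →
      (∀ a ∈ pathVars Pa, ∀ i, ρ a i ≠ some bul) →
      decPath F r bul (ρ.fill (pathVars Pa).toFinset (starVal bul Pa)) (encPath r bul ρ Pa) = ρ
  | ρ, [], hv, _ => absurd hv id
  | ρ, [st], ⟨hT, hpre, hne⟩, hbul => by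
    have hmem := mem_of_firstLive hT
    have hnd := hF _ hmem
    have hlen := hr _ hmem
    have hW : (pathVars [st]).toFinset = st.vars.toFinset := by simp
    rw [hW]
    have hvars : ∀ a ∈ st.vars, ∃ l ∈ st.term, l.1.1 = a := fun a ha => by
      obtain ⟨l, hl, hla, _⟩ := mem_blkSet.1 (mem_blkList.1 (hpre.subset ha)); exact ⟨l, hl, hla⟩
    have hfl : firstLive F (ρ.fill st.vars.toFinset (starVal bul [st])) = some st.term :=
      firstLive_hybrid hF hT (fun l _ hlW _ => List.mem_toFinset.1 hlW)
    have hdec : decBlocks st.term (encStage r st) = st.vars.map fun a => (a, st.ans a) :=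
      decBlocks_encStage hlen st.ans hvars
    have hbl : (st.vars.map fun a => (a, st.ans a)).map Prod.fst = st.vars := by
      rw [List.map_map]; simp [Function.comp_def]
    have hbul' : ∀ a ∈ st.vars, ∀ i, ρ a i ≠ some bul := fun a ha => hbul a (by simpa using ha)
    rw [show encPath r bul ρ [st] = [(encStage r st, maskOf r bul ρ st)] from rfl]
    unfold decPath
    simp only [hfl, hdec, hbl]
    unfold decPath
    rw [undo_hybrid hlen (fun a ha => List.mem_toFinset.2 ha) hbul' (fun a ha => bitOf_map_self st.ans ha)]
    rw [Finset.sdiff_self, BRestr.fill_empty]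
    exact restore_hybrid hlen (fun a ha => List.mem_toFinset.2 ha) hbul'
  | ρ, st :: st' :: rest, ⟨hT, hvarsEq, hne, hrest⟩, hbul => by
    have hv : PathValidLast F ρ (st :: st' :: rest) := ⟨hT, hvarsEq, hne, hrest⟩
    have hndW := hv.nodup_star.1
    have hmem := mem_of_firstLive hT
    have hnd := hF _ hmem
    have hlen := hr _ hmem
    set W := (pathVars (st :: st' :: rest)).toFinset with hWdef
    have hstW : ∀ a ∈ st.vars, a ∈ W := fun a ha => by
      rw [hWdef, List.mem_toFinset, pathVars_cons]; exact List.mem_append_left _ ha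
    have hvars : ∀ a ∈ st.vars, ∃ l ∈ st.term, l.1.1 = a := fun a ha => by
      rw [hvarsEq] at ha
      obtain ⟨l, hl, hla, _⟩ := mem_blkSet.1 (mem_blkList.1 ha); exact ⟨l, hl, hla⟩
    have hfl : firstLive F (ρ.fill W (starVal bul (st :: st' :: rest))) = some st.term :=
      firstLive_hybrid hF hT (fun l hl _ hn => by
        rw [hvarsEq, mem_blkList]; exact mem_blkSet.2 ⟨l, hl, rfl, hn⟩)
    have hdec : decBlocks st.term (encStage r st) = st.vars.map fun a => (a, st.ans a) :=
      decBlocks_encStage hlen st.ans hvars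
    have hbl : (st.vars.map fun a => (a, st.ans a)).map Prod.fst = st.vars := by
      rw [List.map_map]; simp [Function.comp_def]
    have hbul' : ∀ a ∈ st.vars, ∀ i, ρ a i ≠ some bul :=
      fun a ha => hbul a (by rw [pathVars_cons]; exact List.mem_append_left _ ha)
    have hsplit : encPath r bul ρ (st :: st' :: rest) =
        (encStage r st, maskOf r bul ρ st) :: encPath r bul (st.next ρ) (st' :: rest) := rfl
    rw [hsplit]
    generalize hE : encPath r bul (st.next ρ) (st' :: rest) = E
    unfold decPath
    simp only [hfl, hdec, hbl]
    subst hE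
    rw [undo_hybrid hlen hstW hbul' (fun a ha => bitOf_map_self st.ans ha)]
    have hWV : W \ st.vars.toFinset = (pathVars (st' :: rest)).toFinset := by
      rw [hWdef]
      ext a
      simp only [Finset.mem_sdiff, List.mem_toFinset, pathVars_cons (st := st), List.mem_append]
      constructor
      · rintro ⟨h | h, h2⟩
        · exact absurd h h2
        · exact h
      · intro h
        refine ⟨Or.inr h, fun h2 => ?_⟩
        exact List.disjoint_of_nodup_append (pathVars_cons st (st' :: rest) ▸ hndW) h2 h
    rw [hWV]
    have ih := decPath_encPath bul hF hr (ρ := st.next ρ) (Pa := st' :: rest) hrest (fun a ha i => by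
      have hast : a ∉ st.vars := fun h2 =>
        List.disjoint_of_nodup_append (pathVars_cons st (st' :: rest) ▸ hndW) h2 ha
      unfold Stage.next
      rw [BRestr.fill_of_not_mem (by simpa using hast)]
      exact hbul a (by rw [pathVars_cons]; exact List.mem_append_right _ ha) i)
    rw [ih]
    exact restore_hybrid hlen hstW hbul'

end Coding

/-! ### The code of a bad restriction and its injectivity -/

section BadCode

variable {A P : Type*} [DecidableEq A] [DecidableEq P] [Fintype A] [Fintype P]
variable (F : CNF (A × P)) (r : ℕ) (bul : Bool) (s : ℕ)

/-- The path chosen for a bad restriction (`pcdt F ρ ≥ s ≥ 1`): a full long path of `Tree(F↾ρ)`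
truncated to exactly `s` block variables. [cite: RossmanServedioTan2015, §9.3 (p. 25–26)] -/
def badPath (ρ : BRestr A P) : List (Stage A P) :=
  if h : 1 ≤ s ∧ s ≤ pcdt F ρ then
    truncPath (Classical.choose (exists_path_of_lt_pcdtF F (Fintype.card A) ρ (s - 1) (by unfold pcdt at h; omega))) s
  else []

omit [DecidableEq P] [Fintype P] in
/-- The chosen path is a valid truncated path with exactly `s` block variables. [cite: RossmanServedioTan2015, §9.3 (p. 25–26)] -/
theorem badPath_spec {ρ : BRestr A P} (h1 : 1 ≤ s) (h : s ≤ pcdt F ρ) :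
    PathValidLast F ρ (badPath F s ρ) ∧ pathLen (badPath F s ρ) = s := by
  unfold badPath
  rw [dif_pos ⟨h1, h⟩]
  have hP := Classical.choose_spec (exists_path_of_lt_pcdtF F (Fintype.card A) ρ (s - 1) (by unfold pcdt at h; omega))
  exact truncPath_valid hP.1 h1 (by omega)

/-- The restriction `ρσ` of the encoding (stars of the queried blocks filled by `σ`). [cite: RossmanServedioTan2015, §9.3 (p. 25)] -/
def badStar (ρ : BRestr A P) : BRestr A P :=
  ρ.fill (pathVars (badPath F s ρ)).toFinset (starVal bul (badPath F s ρ))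

/-- The letters of the code of a bad restriction (with block marks). [cite: RossmanServedioTan2015, §9.3 (p. 25–26)] -/
def badLetters (ρ : BRestr A P) : List (Letter r × Bool) :=
  flatL ((encPath r bul ρ (badPath F s ρ)).map Prod.fst)

/-- The masks of the code of a bad restriction. [cite: RossmanServedioTan2015, §9.3 (p. 26)] -/
def badMasks (ρ : BRestr A P) : List (Fin (r + 1) → Bool) := (encPath r bul ρ (badPath F s ρ)).map Prod.snd

/-- **The code `θ(ρ)`** in a fixed finite type: `s` letters, at most `s` masks, and `ρσ`. [cite: RossmanServedioTan2015, §9.4 (p. 26, the injection proposition)] -/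
def badCode (ρ : BRestr A P) :
    (Fin s → Option (Letter r × Bool)) × (Fin s → Option (Fin (r + 1) → Bool)) × BRestr A P :=
  (fun k => (badLetters F r bul s ρ)[k.val]?, fun k => (badMasks F r bul s ρ)[k.val]?, badStar F bul s ρ)

omit [DecidableEq P] [Fintype A] [Fintype P] in
/-- The code of a path has one letter per queried block variable. [folklore] -/
theorem length_flatL_encPath : ∀ (ρ : BRestr A P) (Pa : List (Stage A P)),
    (flatL ((encPath r bul ρ Pa).map Prod.fst)).length = pathLen Pa
  | _, [] => rfl
  | ρ, st :: rest => by
    have := length_flatL_encPath (st.next ρ) rest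
    rw [length_flatL] at this ⊢
    simpa [encPath, encStage] using this

omit [DecidableEq P] [Fintype A] [Fintype P] in
/-- The code of a path has one mask per stage. [folklore] -/
theorem length_encPath : ∀ (ρ : BRestr A P) (Pa : List (Stage A P)), (encPath r bul ρ Pa).length = Pa.length
  | _, [] => rfl
  | ρ, st :: rest => by simp [encPath, length_encPath (st.next ρ) rest]

omit [DecidableEq A] [DecidableEq P] [Fintype A] [Fintype P] in
/-- A path has at most `pathLen` stages when every stage queries a block. [folklore] -/
theorem length_le_pathLen : ∀ {Pa : List (Stage A P)}, (∀ st ∈ Pa, st.vars ≠ []) → Pa.length ≤ pathLen Pa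
  | [], _ => le_rfl
  | st :: rest, h => by
    have h1 : 0 < st.vars.length := List.length_pos_iff.2 (h st (by simp))
    have := length_le_pathLen (Pa := rest) (fun st' hst' => h st' (by simp [hst']))
    simp only [List.length_cons, pathLen_cons]
    omega

omit [DecidableEq P] [Fintype A] [Fintype P] in
/-- The letters, unflattened, are the letter lists of the stages. [folklore] -/
theorem unflatL_letters {Pa : List (Stage A P)} (h : ∀ st ∈ Pa, st.vars ≠ []) :
    ∀ (ρ : BRestr A P), unflatL (flatL ((encPath r bul ρ Pa).map Prod.fst)) = (encPath r bul ρ Pa).map Prod.fst := by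
  intro ρ
  apply unflatL_flatL
  intro l hl
  induction Pa generalizing ρ with
  | nil => simp [encPath] at hl
  | cons st rest ih =>
    simp only [encPath, List.map_cons, List.mem_cons] at hl
    rcases hl with rfl | hl
    · simpa [encStage] using h st (by simp)
    · exact ih (fun st' hst' => h st' (by simp [hst'])) (st.next ρ) hl

/-- The set on which the code is injective: bad restrictions none of whose queried blocks holds a
`•` (automatic on the support of the random projection). [cite: RossmanServedioTan2015, §9.3 (p. 25, (ii)–(iv))] -/
def BadSet : Finset (BRestr A P) :=
  univ.filter fun ρ => s ≤ pcdt F ρ ∧ ∀ a ∈ pathVars (badPath F s ρ), ∀ i, ρ a i ≠ some bul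

/-- **The encoding is injective** (RST §9.4). [cite: RossmanServedioTan2015, §9.4 (p. 26, the injection proposition)] -/
theorem badCode_injOn (hF : ∀ T ∈ F, VarNodup T) (hr : ∀ T ∈ F, T.length ≤ r) (hs : 1 ≤ s) :
    Set.InjOn (badCode F r bul s) (BadSet F bul s : Finset (BRestr A P)) := by
  intro ρ₁ h₁ ρ₂ h₂ heq
  simp only [BadSet, Finset.coe_filter, Finset.mem_univ, true_and, Set.mem_setOf_eq] at h₁ h₂
  simp only [badCode, Prod.mk.injEq] at heq
  obtain ⟨hL, hM, hS⟩ := heq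
  obtain ⟨hv₁, hlen₁⟩ := badPath_spec F s hs h₁.1
  obtain ⟨hv₂, hlen₂⟩ := badPath_spec F s hs h₂.1
  have hne₁ := hv₁.stages_ne_nil
  have hne₂ := hv₂.stages_ne_nil
  -- the letters agree
  have hl₁ : (badLetters F r bul s ρ₁).length ≤ s := by
    rw [badLetters, length_flatL_encPath r bul ρ₁, hlen₁]
  have hl₂ : (badLetters F r bul s ρ₂).length ≤ s := by
    rw [badLetters, length_flatL_encPath r bul ρ₂, hlen₂]
  have hLL : badLetters F r bul s ρ₁ = badLetters F r bul s ρ₂ :=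
    list_eq_of_getElem?_eq hl₁ hl₂ fun k hk => congrFun hL ⟨k, hk⟩
  have hfst : (encPath r bul ρ₁ (badPath F s ρ₁)).map Prod.fst = (encPath r bul ρ₂ (badPath F s ρ₂)).map Prod.fst := by
    rw [← unflatL_letters r bul hne₁ ρ₁, ← unflatL_letters r bul hne₂ ρ₂]
    exact congrArg unflatL hLL
  -- the masks agree
  have hcnt₁ : (badMasks F r bul s ρ₁).length ≤ s := by
    rw [badMasks, List.length_map, length_encPath]
    calc (badPath F s ρ₁).length ≤ pathLen (badPath F s ρ₁) := length_le_pathLen hne₁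
      _ = s := hlen₁
  have hcnt₂ : (badMasks F r bul s ρ₂).length ≤ s := by
    rw [badMasks, List.length_map, length_encPath]
    calc (badPath F s ρ₂).length ≤ pathLen (badPath F s ρ₂) := length_le_pathLen hne₂
      _ = s := hlen₂
  have hMM : badMasks F r bul s ρ₁ = badMasks F r bul s ρ₂ :=
    list_eq_of_getElem?_eq hcnt₁ hcnt₂ fun k hk => congrFun hM ⟨k, hk⟩
  -- hence the codes agree
  have hcode : encPath r bul ρ₁ (badPath F s ρ₁) = encPath r bul ρ₂ (badPath F s ρ₂) := by
    rw [← List.zip_unzip (encPath r bul ρ₁ (badPath F s ρ₁)), ← List.zip_unzip (encPath r bul ρ₂ (badPath F s ρ₂))]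
    simp only [List.unzip_eq_map]
    rw [hfst]
    change _ = ((encPath r bul ρ₂ (badPath F s ρ₂)).map Prod.fst).zip (badMasks F r bul s ρ₂)
    rw [← hMM]; rfl
  -- decode
  have d₁ := decPath_encPath bul hF hr hv₁ h₁.2
  have d₂ := decPath_encPath bul hF hr hv₂ h₂.2
  change decPath F r bul (badStar F bul s ρ₁) _ = ρ₁ at d₁
  change decPath F r bul (badStar F bul s ρ₂) _ = ρ₂ at d₂
  rw [← d₁, ← d₂, hS, hcode]

end BadCode

/-! ### Weights: the comparison `ξ(ρσ) ≥ Γ^s κ^{‖γ‖} ξ(ρ)` (RST §9.5) -/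

section Weights

variable {A P : Type*} [DecidableEq A] [DecidableEq P] [Fintype A] [Fintype P]

/-- The product weight `ξ(ρ) = ∏_a ζ_a(ρ_a)` of a restriction under independent blocks
(RST §9.5, the two Facts giving the mass functions of `R(τ)` and `R_init`). [cite: RossmanServedioTan2015, §9.5 (p. 27, the probability mass function of `R(τ)`)] -/
def bw (ζ : A → (P → Option Bool) → ℝ) (ρ : BRestr A P) : ℝ := ∏ a, ζ a (ρ a)

/-- The Hamming weight of a mask. [folklore] -/
def wt {r : ℕ} (M : Fin (r + 1) → Bool) : ℕ := (univ.filter fun p => M p = true).card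

/-- The Hamming weight of an optional mask (`0` for none). [folklore] -/
def owt {r : ℕ} : Option (Fin (r + 1) → Bool) → ℕ
  | none => 0
  | some M => wt M

omit [DecidableEq A] [DecidableEq P] [Fintype A] [Fintype P] in
/-- Weight of no mask. [folklore] -/
@[simp] theorem owt_none {r : ℕ} : owt (none : Option (Fin (r + 1) → Bool)) = 0 := rfl

omit [DecidableEq A] [DecidableEq P] [Fintype A] [Fintype P] in
/-- Weight of a mask. [folklore] -/
@[simp] theorem owt_some {r : ℕ} (M : Fin (r + 1) → Bool) : owt (some M) = wt M := rfl

/-- The total Hamming weight `‖encode(γ)‖` of the masks of a path. [cite: RossmanServedioTan2015, §9.5 (p. 27, `‖ϑ₄‖`)] -/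
def maskTotal (r : ℕ) (bul : Bool) (ρ : BRestr A P) (Pa : List (Stage A P)) : ℕ :=
  ((encPath r bul ρ Pa).map fun c => wt c.2).sum

/-- The number of new `∘`'s in the block `a`: stars of `ρ` that `σ` sets to `∘` (RST's `Δ_a`). [cite: RossmanServedioTan2015, §9.5 (p. 28, `Δ_a`)] -/
def newCirc (bul : Bool) (ρ : BRestr A P) (g : A → P → Bool) (a : A) : ℕ :=
  (univ.filter fun i => ρ a i = none ∧ g a i = !bul).card

/-- `Σ_a Δ_a` over the queried blocks. [cite: RossmanServedioTan2015, §9.5 (p. 28)] -/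
def newCircTotal (bul : Bool) (ρ : BRestr A P) (Pa : List (Stage A P)) : ℕ :=
  ∑ a ∈ (pathVars Pa).toFinset, newCirc bul ρ (starVal bul Pa) a

omit [Fintype A] in
/-- **The mask of a stage counts its new `∘`'s**: `|γ_ℓ| = Σ_{a ∈ η_ℓ} Δ_a`. [cite: RossmanServedioTan2015, §9.5 (p. 28, "`Σ_a Δ_a = ‖ϑ₄‖`")] -/
theorem wt_maskOf {r : ℕ} (bul : Bool) {ρ : BRestr A P} {st : Stage A P} (hnd : VarNodup st.term)
    (hlen : st.term.length ≤ r) :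
    wt (maskOf r bul ρ st) = ∑ a ∈ st.vars.toFinset, newCirc bul ρ (fun a i => tpol bul st.term (a, i)) a := by
  classical
  -- the right-hand side as one set of pairs
  have hR : ∑ a ∈ st.vars.toFinset, newCirc bul ρ (fun a i => tpol bul st.term (a, i)) a =
      ((st.vars.toFinset ×ˢ (univ : Finset P)).filter
        fun v => ρ v.1 v.2 = none ∧ tpol bul st.term v = !bul).card := by
    rw [Finset.card_filter, Finset.sum_product]
    refine Finset.sum_congr rfl fun a _ => ?_
    rw [newCirc, Finset.card_filter]
  rw [hR, wt]
  -- bijection: masked position ↦ its variable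
  have hlt : ∀ p ∈ univ.filter (fun p : Fin (r + 1) => maskOf r bul ρ st p = true), p.val < st.term.length := by
    intro p hp
    obtain ⟨l, hl, -⟩ := maskOf_eq_true_iff.1 (Finset.mem_filter.1 hp).2
    exact (List.getElem?_eq_some_iff.1 hl).1
  refine Finset.card_bij (fun p hp => (st.term[p.val]'(hlt p hp)).1) ?_ ?_ ?_
  · intro p hp
    obtain ⟨l, hl, hvars, hn, hb⟩ := maskOf_eq_true_iff.1 (Finset.mem_filter.1 hp).2
    have hpl : st.term[p.val]'(hlt p hp) = l := (List.getElem?_eq_some_iff.1 hl).2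
    simp only [Finset.mem_filter, Finset.mem_product, List.mem_toFinset, Finset.mem_univ, and_true, hpl]
    refine ⟨hvars, hn, ?_⟩
    rw [hnd.tpol_eq bul (hpl ▸ List.getElem_mem _), hb]
  · intro p₁ hp₁ p₂ hp₂ he
    exact Fin.ext (hnd.getElem_fst_injective (hlt p₁ hp₁) (hlt p₂ hp₂) he)
  · intro v hv
    simp only [Finset.mem_filter, Finset.mem_product, List.mem_toFinset, Finset.mem_univ, and_true] at hv
    obtain ⟨hva, hn, htp⟩ := hv
    have hne : tpol bul st.term v ≠ bul := by rw [htp]; cases bul <;> decide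
    obtain ⟨l, hl, hl1, hl2⟩ := exists_mem_of_tpol_ne hne
    obtain ⟨k, hk, rfl⟩ := List.getElem_of_mem hl
    refine ⟨⟨k, by omega⟩, ?_, hl1⟩
    rw [Finset.mem_filter, maskOf_eq_true_iff]
    refine ⟨Finset.mem_univ _, st.term[k], List.getElem?_eq_getElem hk, ?_, ?_, ?_⟩
    · rw [show (st.term[k]).1.1 = v.1 from congrArg Prod.fst hl1]; exact hva
    · rw [hl1]; exact hn
    · rw [hl2, htp]

/-- **`‖encode(γ)‖ = Σ_a Δ_a`** along a valid truncated path. [cite: RossmanServedioTan2015, §9.5 (p. 28)] -/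
theorem maskTotal_eq_newCircTotal {F : CNF (A × P)} {r : ℕ} (bul : Bool) (hF : ∀ T ∈ F, VarNodup T)
    (hr : ∀ T ∈ F, T.length ≤ r) :
    ∀ {ρ : BRestr A P} {Pa : List (Stage A P)}, PathValidLast F ρ Pa →
      maskTotal r bul ρ Pa = newCircTotal bul ρ Pa
  | ρ, [], hv => absurd hv id
  | ρ, [st], ⟨hT, _, _⟩ => by
    classical
    have hmem := mem_of_firstLive hT
    simp only [maskTotal, encPath, List.map_cons, List.map_nil, List.sum_cons, List.sum_nil, add_zero,
      newCircTotal, pathVars_cons, pathVars_nil, List.append_nil]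
    rw [wt_maskOf bul (hF _ hmem) (hr _ hmem)]
    refine Finset.sum_congr rfl fun a ha => ?_
    simp only [newCirc, starVal, List.mem_toFinset.1 ha, if_true]
  | ρ, st :: st' :: rest, ⟨hT, hvarsEq, hne, hrest⟩ => by
    classical
    have hv : PathValidLast F ρ (st :: st' :: rest) := ⟨hT, hvarsEq, hne, hrest⟩
    have hndW := hv.nodup_star.1
    have hmem := mem_of_firstLive hT
    have ih := maskTotal_eq_newCircTotal bul hF hr hrest
    have hdisj : Disjoint st.vars.toFinset (pathVars (st' :: rest)).toFinset := by
      rw [Finset.disjoint_left]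
      intro a ha ha'
      exact List.disjoint_of_nodup_append (pathVars_cons st (st' :: rest) ▸ hndW)
        (List.mem_toFinset.1 ha) (List.mem_toFinset.1 ha')
    have hsplit : maskTotal r bul ρ (st :: st' :: rest) =
        wt (maskOf r bul ρ st) + maskTotal r bul (st.next ρ) (st' :: rest) := by
      simp [maskTotal, encPath]
    rw [hsplit, ih, wt_maskOf bul (hF _ hmem) (hr _ hmem), newCircTotal, newCircTotal,
      show (pathVars (st :: st' :: rest)).toFinset = st.vars.toFinset ∪ (pathVars (st' :: rest)).toFinset by
        rw [pathVars_cons, List.toFinset_append], Finset.sum_union hdisj]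
    congr 1
    · refine Finset.sum_congr rfl fun a ha => ?_
      simp only [newCirc, starVal, List.mem_toFinset.1 ha, if_true]
    · refine Finset.sum_congr rfl fun a ha => ?_
      have hast : a ∉ st.vars := fun h2 =>
        List.disjoint_of_nodup_append (pathVars_cons st (st' :: rest) ▸ hndW) h2 (List.mem_toFinset.1 ha)
      have hnext : ∀ i, st.next ρ a i = ρ a i := fun i => by
        unfold Stage.next; rw [BRestr.fill_of_not_mem]; simpa using hast
      simp only [newCirc, starVal, hast, if_false, hnext]

omit [DecidableEq P] in
/-- The queried blocks of the chosen path: `s` distinct star blocks. [folklore] -/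
theorem card_pathVars_badPath {F : CNF (A × P)} {s : ℕ} {ρ : BRestr A P} (hs : 1 ≤ s) (h : s ≤ pcdt F ρ) :
    (pathVars (badPath F s ρ)).toFinset.card = s := by
  obtain ⟨hv, hlen⟩ := badPath_spec F s hs h
  rw [List.toFinset_card_of_nodup hv.nodup_star.1, length_pathVars, hlen]

/-- **Weight comparison** (RST §9.5, eq. (19)): under the block-ratio hypothesis,
`Γ^s κ^{Σ_a Δ_a} ξ(ρ) ≤ ξ(ρσ)` for a bad `ρ` of positive weight. [cite: RossmanServedioTan2015, §9.5 (p. 28, eq. (19))] -/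
theorem weight_badStar_ge (ζ : A → (P → Option Bool) → ℝ) (hζ : ∀ a ϱ, 0 ≤ ζ a ϱ) (bul : Bool)
    {Γ κ : ℝ} (hΓ : 0 ≤ Γ) (hκ : 0 ≤ κ)
    (hratio : ∀ a (ϱ : P → Option Bool) (g : P → Bool), 0 < ζ a ϱ → (∃ i, ϱ i = none) →
      Γ * κ ^ (univ.filter fun i => ϱ i = none ∧ g i = !bul).card * ζ a ϱ ≤
        ζ a (fun i => some ((ϱ i).getD (g i))))
    (F : CNF (A × P)) {s : ℕ} (hs : 1 ≤ s) {ρ : BRestr A P} (h : s ≤ pcdt F ρ) (hpos : ∀ a, 0 < ζ a (ρ a)) :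
    Γ ^ s * κ ^ newCircTotal bul ρ (badPath F s ρ) * bw ζ ρ ≤ bw ζ (badStar F bul s ρ) := by
  classical
  obtain ⟨hv, hlen⟩ := badPath_spec F s hs h
  set W := (pathVars (badPath F s ρ)).toFinset with hW
  set g := starVal bul (badPath F s ρ) with hg
  have hcard : W.card = s := card_pathVars_badPath hs h
  have hstar : ∀ a ∈ W, ∃ i, ρ a i = none := fun a ha =>
    BRestr.mem_starBlocks.1 (hv.nodup_star.2 a (List.mem_toFinset.1 ha))
  -- split both products over `W` and its complement
  have hsplit : ∀ f : A → ℝ, ∏ a, f a = (∏ a ∈ W, f a) * ∏ a ∈ Wᶜ, f a := fun f =>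
    (Finset.prod_mul_prod_compl W f).symm
  unfold bw
  rw [hsplit, hsplit (fun a => ζ a (badStar F bul s ρ a))]
  have hout : ∏ a ∈ Wᶜ, ζ a (badStar F bul s ρ a) = ∏ a ∈ Wᶜ, ζ a (ρ a) := by
    refine Finset.prod_congr rfl fun a ha => ?_
    have ha' : a ∉ W := Finset.mem_compl.1 ha
    congr 1; funext i
    exact BRestr.fill_of_not_mem ha' _ _
  have hin : ∏ a ∈ W, (Γ * κ ^ newCirc bul ρ g a * ζ a (ρ a)) ≤ ∏ a ∈ W, ζ a (badStar F bul s ρ a) := by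
    refine Finset.prod_le_prod (fun a _ => ?_) fun a ha => ?_
    · exact mul_nonneg (mul_nonneg hΓ (pow_nonneg hκ _)) (hζ _ _)
    · have e : badStar F bul s ρ a = fun i => some ((ρ a i).getD (g a i)) := by
        funext i
        show BRestr.fill ρ W g a i = _
        rw [BRestr.fill_apply, if_pos ha]
      rw [e]
      exact hratio a (ρ a) (g a) (hpos a) (hstar a ha)
  rw [Finset.prod_mul_distrib, Finset.prod_mul_distrib, Finset.prod_const, hcard,
    Finset.prod_pow_eq_pow_sum] at hin
  rw [hout, newCircTotal]
  calc Γ ^ s * κ ^ (∑ a ∈ W, newCirc bul ρ g a) * ((∏ a ∈ W, ζ a (ρ a)) * ∏ a ∈ Wᶜ, ζ a (ρ a))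
      = (Γ ^ s * κ ^ (∑ a ∈ W, newCirc bul ρ g a) * ∏ a ∈ W, ζ a (ρ a)) * ∏ a ∈ Wᶜ, ζ a (ρ a) := by ring
    _ ≤ (∏ a ∈ W, ζ a (badStar F bul s ρ a)) * ∏ a ∈ Wᶜ, ζ a (ρ a) :=
        mul_le_mul_of_nonneg_right hin (Finset.prod_nonneg fun a _ => hζ _ _)

end Weights

/-! ### The projection switching lemma, abstract counting form (RST §9.1 via §9.5) -/

section Main

variable {A P : Type*} [DecidableEq A] [DecidableEq P] [Fintype A] [Fintype P]

omit [DecidableEq A] [DecidableEq P] [Fintype A] [Fintype P] in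
/-- Summing `owt` over the padded `Fin s`-indexed masks gives the total mask weight. [folklore] -/
theorem sum_fin_owt {r : ℕ} : ∀ (s : ℕ) (L : List (Fin (r + 1) → Bool)), L.length ≤ s →
    ∑ k : Fin s, owt (L[k.val]?) = (L.map wt).sum
  | 0, [], _ => by simp
  | 0, _ :: _, h => by simp at h
  | s + 1, [], _ => by simp
  | s + 1, M :: L, h => by
    rw [Fin.sum_univ_succ]
    simp only [Fin.val_zero, List.getElem?_cons_zero, owt_some, Fin.val_succ, List.getElem?_cons_succ,
      List.map_cons, List.sum_cons]
    rw [sum_fin_owt s L (by simpa using h)]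

omit [DecidableEq A] [DecidableEq P] [Fintype P] in
/-- A positive product weight has positive factors. [folklore] -/
theorem pos_of_bw_pos {ζ : A → (P → Option Bool) → ℝ} (hζ : ∀ a ϱ, 0 ≤ ζ a ϱ) {ρ : BRestr A P}
    (h : 0 < bw ζ ρ) (a : A) : 0 < ζ a (ρ a) := by
  refine lt_of_le_of_ne (hζ _ _) fun h0 => ?_
  have : bw ζ ρ = 0 := Finset.prod_eq_zero (Finset.mem_univ a) h0.symm
  rw [this] at h; exact lt_irrefl _ h

omit [DecidableEq A] [DecidableEq P] [Fintype A] [Fintype P] in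
/-- `Σ_M κ^{-|M|} = (1 + κ⁻¹)^{r+1}` over all masks. [folklore] -/
theorem sum_masks_pow {r : ℕ} (x : ℝ) :
    ∑ M : Fin (r + 1) → Bool, x ^ wt M = (1 + x) ^ (r + 1) := by
  classical
  have key : ∀ M : Fin (r + 1) → Bool, x ^ wt M = ∏ p, (if M p = true then x else 1) := by
    intro M
    rw [Finset.prod_ite, Finset.prod_const, Finset.prod_const_one, mul_one, wt]
  simp_rw [key]
  have h := Finset.prod_univ_sum (fun (_ : Fin (r + 1)) => (univ : Finset Bool))
    (fun _ b => if b = true then x else 1)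
  simp only [Fintype.piFinset_univ] at h
  rw [← h]
  simp [add_comm]

/-- **Projection switching lemma, abstract counting form** (RST §9.1, proved as in §9.3–9.5).
Let the block weights `ζ_a ≥ 0` satisfy: (support) a block string of positive weight with a star
has no `•`; (ratio) completing the stars of such a string multiplies the weight by at least
`Γ κ^{#new ∘}` (`Γ > 0`, `κ ≥ 1`). Then for a DNF `F` over `A × P` with repetition-free terms of
width `≤ r` and `s ≥ 1`, the `ξ = ∏_a ζ_a`-weight of the restrictions whose canonical projection
decision tree has depth `≥ s` is at most `(Σ_ρ ξ(ρ)) · ((8r+10)(1+κ⁻¹)^{r+1} / Γ)^s`.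
(RST: `(O(r 2^r w^{-1/4}))^s` for `R_init`, `(O(r e^{r t/(1-t)} w^{-1/4}))^s` for `R(τ)`.)
[cite: RossmanServedioTan2015, §9.1 (p. 24, the two projection switching lemmas) and §9.5 (pp. 27–29, their proofs)] -/
theorem psl_abstract (ζ : A → (P → Option Bool) → ℝ) (hζ : ∀ a ϱ, 0 ≤ ζ a ϱ) (bul : Bool)
    {Γ κ : ℝ} (hΓ : 0 < Γ) (hκ : 1 ≤ κ)
    (hsupp : ∀ a (ϱ : P → Option Bool), 0 < ζ a ϱ → (∃ i, ϱ i = none) → ∀ i, ϱ i ≠ some bul)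
    (hratio : ∀ a (ϱ : P → Option Bool) (g : P → Bool), 0 < ζ a ϱ → (∃ i, ϱ i = none) →
      Γ * κ ^ (univ.filter fun i => ϱ i = none ∧ g i = !bul).card * ζ a ϱ ≤
        ζ a (fun i => some ((ϱ i).getD (g i))))
    (F : CNF (A × P)) (hF : ∀ T ∈ F, VarNodup T) {r : ℕ} (hr : ∀ T ∈ F, T.length ≤ r)
    {s : ℕ} (hs : 1 ≤ s) :
    ∑ ρ ∈ univ.filter (fun ρ : BRestr A P => s ≤ pcdt F ρ), bw ζ ρ ≤
      (∑ ρ : BRestr A P, bw ζ ρ) * ((8 * r + 10) * (1 + κ⁻¹) ^ (r + 1) / Γ) ^ s := by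
  classical
  have hκ0 : 0 < κ := lt_of_lt_of_le one_pos hκ
  have hκi : 0 ≤ κ⁻¹ := inv_nonneg.2 hκ0.le
  have hbw0 : ∀ ρ : BRestr A P, 0 ≤ bw ζ ρ := fun ρ => Finset.prod_nonneg fun a _ => hζ _ _
  -- restrict to positive weights (the others contribute nothing) : these lie in `BadSet`
  set Bad := univ.filter (fun ρ : BRestr A P => s ≤ pcdt F ρ) with hBad
  set Bad' := univ.filter (fun ρ : BRestr A P => s ≤ pcdt F ρ ∧ 0 < bw ζ ρ) with hBad'
  have hsub : Bad' ⊆ BadSet F bul s := by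
    intro ρ hρ
    simp only [hBad', Finset.mem_filter, Finset.mem_univ, true_and] at hρ
    refine Finset.mem_filter.2 ⟨Finset.mem_univ _, hρ.1, fun a ha i => ?_⟩
    obtain ⟨hv, _⟩ := badPath_spec F s hs hρ.1
    exact hsupp a (ρ a) (pos_of_bw_pos hζ hρ.2 a) (BRestr.mem_starBlocks.1 (hv.nodup_star.2 a ha)) i
  have step0 : ∑ ρ ∈ Bad, bw ζ ρ = ∑ ρ ∈ Bad', bw ζ ρ := by
    refine (Finset.sum_subset (fun ρ hρ => ?_) (fun ρ hρ hρ' => ?_)).symm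
    · simp only [hBad, hBad', Finset.mem_filter, Finset.mem_univ, true_and] at hρ ⊢; exact hρ.1
    · simp only [hBad, hBad', Finset.mem_filter, Finset.mem_univ, true_and, not_and, not_lt] at hρ hρ'
      exact le_antisymm (hρ' hρ) (hbw0 ρ)
  -- the weight function on codes
  let ow : Option (Fin (r + 1) → Bool) → ℝ := fun o => κ⁻¹ ^ owt o
  let G : (Fin s → Option (Letter r × Bool)) × (Fin s → Option (Fin (r + 1) → Bool)) × BRestr A P → ℝ :=
    fun c => (∏ k, ow (c.2.1 k)) * bw ζ c.2.2
  have hG0 : ∀ c, 0 ≤ G c := fun c => mul_nonneg (Finset.prod_nonneg fun k _ => pow_nonneg hκi _) (hbw0 _)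
  -- step 1: pointwise weight transfer `bw ρ ≤ G (code ρ) / Γ^s`
  have step1 : ∀ ρ ∈ Bad', bw ζ ρ ≤ G (badCode F r bul s ρ) / Γ ^ s := by
    intro ρ hρ
    simp only [hBad', Finset.mem_filter, Finset.mem_univ, true_and] at hρ
    obtain ⟨hv, hlen⟩ := badPath_spec F s hs hρ.1
    have hpos := pos_of_bw_pos hζ hρ.2
    have hw := weight_badStar_ge ζ hζ bul hΓ.le hκ0.le hratio F hs hρ.1 hpos
    rw [← maskTotal_eq_newCircTotal bul hF hr hv] at hw
    -- the mask factor of the code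
    have hmask : ∏ k : Fin s, ow ((badMasks F r bul s ρ)[k.val]?) = κ⁻¹ ^ maskTotal r bul ρ (badPath F s ρ) := by
      simp only [ow]
      rw [Finset.prod_pow_eq_pow_sum, sum_fin_owt s (badMasks F r bul s ρ)]
      · rw [maskTotal, badMasks, List.map_map]; rfl
      · rw [badMasks, List.length_map, length_encPath]
        calc (badPath F s ρ).length ≤ pathLen (badPath F s ρ) := length_le_pathLen hv.stages_ne_nil
          _ = s := hlen
    have hGc : G (badCode F r bul s ρ) = κ⁻¹ ^ maskTotal r bul ρ (badPath F s ρ) * bw ζ (badStar F bul s ρ) := by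
      simp only [G, badCode]; rw [hmask]
    rw [hGc, le_div_iff₀ (pow_pos hΓ s)]
    have hκpow : 0 < κ ^ maskTotal r bul ρ (badPath F s ρ) := pow_pos hκ0 _
    calc bw ζ ρ * Γ ^ s = (Γ ^ s * κ ^ maskTotal r bul ρ (badPath F s ρ) * bw ζ ρ) *
          κ⁻¹ ^ maskTotal r bul ρ (badPath F s ρ) := by
            rw [inv_pow]; field_simp
      _ ≤ bw ζ (badStar F bul s ρ) * κ⁻¹ ^ maskTotal r bul ρ (badPath F s ρ) :=
          mul_le_mul_of_nonneg_right hw (pow_nonneg hκi _)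
      _ = _ := by ring
  -- step 2: sum and use injectivity
  have step2 : ∑ ρ ∈ Bad', bw ζ ρ ≤ (∑ c, G c) / Γ ^ s := by
    calc ∑ ρ ∈ Bad', bw ζ ρ ≤ ∑ ρ ∈ Bad', G (badCode F r bul s ρ) / Γ ^ s := Finset.sum_le_sum step1
      _ = (∑ ρ ∈ Bad', G (badCode F r bul s ρ)) / Γ ^ s := by rw [Finset.sum_div]
      _ = (∑ c ∈ Bad'.image (badCode F r bul s), G c) / Γ ^ s := by
          rw [Finset.sum_image ((badCode_injOn F r bul s hF hr hs).mono (by exact_mod_cast hsub))]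
      _ ≤ (∑ c, G c) / Γ ^ s :=
          div_le_div_of_nonneg_right (Finset.sum_le_sum_of_subset_of_nonneg (Finset.subset_univ _)
            fun c _ _ => hG0 c) (pow_nonneg hΓ.le _)
  -- step 3: the total weight of codes
  have hletters : Fintype.card (Fin s → Option (Letter r × Bool)) = (4 * r + 5) ^ s := by
    rw [Fintype.card_fun, Fintype.card_fin, Fintype.card_option, Fintype.card_prod, Fintype.card_bool]
    have : Fintype.card (Letter r) = 2 * (r + 1) := by
      rw [show Fintype.card (Letter r) = Fintype.card (Fin (r + 1) × Bool) from
        Fintype.card_congr ⟨fun e => (e.pos, e.bit), fun q => ⟨q.1, q.2⟩, fun _ => rfl, fun _ => rfl⟩]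
      simp [mul_comm]
    rw [this]; ring_nf
  have howsum : ∑ o : Option (Fin (r + 1) → Bool), ow o = 1 + (1 + κ⁻¹) ^ (r + 1) := by
    rw [Fintype.sum_option]
    simp only [ow, owt, pow_zero]
    rw [sum_masks_pow]
  have hmasks : ∑ M : Fin s → Option (Fin (r + 1) → Bool), ∏ k, ow (M k) = (1 + (1 + κ⁻¹) ^ (r + 1)) ^ s := by
    have h := Finset.prod_univ_sum (fun (_ : Fin s) => (univ : Finset (Option (Fin (r + 1) → Bool))))
      (fun _ o => ow o)
    simp only [Fintype.piFinset_univ] at h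
    rw [← h]
    simp [howsum]
  have step3 : ∑ c, G c = (4 * r + 5 : ℝ) ^ s * (1 + (1 + κ⁻¹) ^ (r + 1)) ^ s * ∑ ρ : BRestr A P, bw ζ ρ := by
    simp only [G, Fintype.sum_prod_type, Finset.sum_const, Finset.card_univ, hletters, nsmul_eq_mul,
      ← Finset.mul_sum, ← Finset.sum_mul, hmasks]
    push_cast; ring
  -- conclusion
  rw [step0]
  refine step2.trans ?_
  rw [step3, div_pow]
  have hM : 0 ≤ ∑ ρ : BRestr A P, bw ζ ρ := Finset.sum_nonneg fun ρ _ => hbw0 ρ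
  have hx : 0 ≤ (1 + κ⁻¹) ^ (r + 1) := pow_nonneg (by linarith) _
  have h1 : 1 ≤ (1 + κ⁻¹) ^ (r + 1) := one_le_pow₀ (by linarith)
  have hcomb : (4 * r + 5 : ℝ) ^ s * (1 + (1 + κ⁻¹) ^ (r + 1)) ^ s ≤ ((8 * r + 10) * (1 + κ⁻¹) ^ (r + 1)) ^ s := by
    rw [← mul_pow]
    refine pow_le_pow_left₀ (by positivity) ?_ _
    nlinarith
  rw [div_le_iff₀ (pow_pos hΓ s)]
  calc (4 * r + 5 : ℝ) ^ s * (1 + (1 + κ⁻¹) ^ (r + 1)) ^ s * ∑ ρ : BRestr A P, bw ζ ρ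
      ≤ ((8 * r + 10) * (1 + κ⁻¹) ^ (r + 1)) ^ s * ∑ ρ : BRestr A P, bw ζ ρ :=
        mul_le_mul_of_nonneg_right hcomb hM
    _ = (∑ ρ : BRestr A P, bw ζ ρ) * (((8 * r + 10) * (1 + κ⁻¹) ^ (r + 1)) ^ s / Γ ^ s) * Γ ^ s := by
        field_simp

omit [DecidableEq P] in
/-- **The decision tree afterwards** (RST §9.2 Fact, the complement of the bad event): if `Tree(F↾ρ)` has
depth `< s` then the projection `y ↦ F(expand ρ y)` has a decision tree over the new variables of
depth `≤ s - 1`. [cite: RossmanServedioTan2015, §9.2 (p. 25, Fact after Def. 13)] -/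
theorem exists_dtree_of_pcdt_lt (F : CNF (A × P)) {ρ : BRestr A P} {s : ℕ} (h : pcdt F ρ < s) :
    ∃ T : DTree A, T.depth ≤ s - 1 ∧ ∀ y, T.eval y = F.evalDNF (ρ.expand y) :=
  exists_dtree_of_pcdt_le F (by omega)

end Main

end RSTProj

end Literature.Computability.Complexity

end
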